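import Literature.Barriers.NavierStokesRegularity.SchefferSwitchedPieces
import Literature.Barriers.NavierStokesRegularity.NavierStokesInequalityArrangementConclusion
import Literature.Barriers.NavierStokesRegularity.NavierStokesInequalityProfilesProofs
import Literature.Barriers.NavierStokesRegularity.NavierStokesInequalitySingularSolutionHolds
import Literature.Barriers.NavierStokesRegularity.SchefferSwitchedIntegrability
import Literature.Barriers.NavierStokesRegularity.NavierStokesInequalityGluingWeak
import Literature.Barriers.NavierStokesRegularity.SchefferSwitchedSingular
import Literature.Barriers.NavierStokesRegularity.NSITypeIIBlowup
import HarnessLib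

/-!
# The barrier `NSITypeIIBlowup` HOLDS — the super-similar Scheffer–Ożański NSI cascade (re-homed proofs)

**The model-class barrier `Literature.Barriers.NavierStokesRegularity.NSITypeIIBlowup` HOLDS** («suitability is rate-blind»): there
is a `ν₀ > 0` and ONE compactly supported field, smooth in space at every time, which is a weak solution of the Navier–Stokes INEQUALITY
for every `ν ∈ [0, ν₀]`, bounded on `[0, T']` for every `T' < T₀`, singular at `(T₀, x₀)`, with `sup_x |u(t, x)| ≥ c (T₀ − t)^{−β}` for
some `β > 1/2` on `[0, T₀)` — a NON-Type-I rate; hence ε-regularity / local-energy-inequality methods cannot by themselves exclude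
non-Type-I blow-up (barrier block of `NSITypeIIBlowup.lean`; the `σ = τ`, `a = τ⁻¹` cascade is W. S. Ożański, *Weak solutions to the
Navier–Stokes inequality with arbitrary energy profiles* / the Scheffer constructions [Ozanski2017NSISingular, §2 pp. 6–7, §5.5;
Ozanski2019NSI, Def. 1.1; Scheffer 1985/1987]).  ARCHITECTURE of the in-tree proof (kernel-checked; until now Summits-side only,
`Summits/NavierStokesRegularity/NavierStokesRegularity/Theorems/TypeIliouvilleNoTypeII/Negative/NSITypeIIBlowupHolds.lean`): B1
`exists_superGain_nsiBlock` — an NSI block `(T, ν₀, τ, z, G, u)` with a super-similar gain `g > τ⁻¹` (`NSISuperSimilarSeed`,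
`NSISuperGainBlock`, on the tree's Literature layer `NavierStokesInequalityProfilesProofs` / `…SingularSolutionHolds` / `SchefferSwitchedPieces`);
the capped amplitude `a := min g (τ⁻¹(√τ)⁻¹)` and clock `σ := √(τ/a)` (`superCascade_params`, `IsSuperBlock`); B2 the glued field
`glueG T σ τ a z u` is a weak NSI solution for every `ν ∈ [0, ν₀]` with `C^∞` slices (`NSISuperCascade{NotTypeI,Pieces,Strips,Weak}` over
`SchefferSwitchedIntegrability`, `NavierStokesInequalityGluingWeak`); B3 `(T₀, x₀) = (blowupTime T σ, blowupPoint τ z)` is singular, the field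
is bounded before `T₀`, and the rate clause holds with `β = log a / log σ⁻² > 1/2` (`NSISuperCascadeSingular` over `SchefferSwitchedSingular`).
RE-HOMED into `Literature/Barriers/` by the Hodge foundations lane (`lit-hodgefound`, seat p20, generation 38): verbatim DECLARATION-LEVEL
ports of the 8 Summits modules `…/Negative/{NSISuperSimilarSeed (1), NSISuperGainBlock (6), NSISuperCascadeNotTypeI (12), NSISuperCascadePieces (40),
NSISuperCascadeStrips (16), NSISuperCascadeWeak (16), NSISuperCascadeSingular (8)}.lean`, namespace
`Summit.NavierStokesRegularity.NavierStokesRegularity.Theorems.TypeIliouvilleNoTypeIINegative` re-rooted as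
`Literature.Barriers.NavierStokesRegularity.NSISuperCascade` (sub-namespace `IsSuperBlock` kept; the local notation `ℝ^3` of `Pieces` is
spelled out as `EuclideanSpace ℝ (Fin 3)`), followed by the EXACT-name discharge `Literature.Barriers.NavierStokesRegularity.NSITypeIIBlowup_holds`.
The gadgets `pieceG`, `glueG` and the structure `IsSuperBlock` come with their bodies; no new named fact (D-0026), no Summits import; built on
the tree's Literature layer (`Barriers/NavierStokesRegularity/{NavierStokesInequality*, SchefferSwitched*}`, `Analysis/FluidPDE/*`) and Mathlib.
The Summits originals stay in place (transitional duplication).  WHAT THIS IS NOT: not a statement about the Navier–Stokes EQUATIONS — the NSI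
class is strictly larger; the theorem certifies the barrier exactly as stated in `NSITypeIIBlowup.lean`, nothing more.
-/

noncomputable section

/-!
## Part 1 — port of `Summits/NavierStokesRegularity/NavierStokesRegularity/Theorems/TypeIliouvilleNoTypeII/Negative/NSISuperSimilarSeed.lean` (1 declarations kept)

# Negative-lane seed for «suitability is rate-blind»: the super-self-similar NSI cascade

Support file (`--supports stmt-NavierStokesRegularity-0056`, the residual `NoTypeII` of the
Type-I Liouville door) recording, as kernel-checked lemmas, the two load-bearing ingredients of
critic-1's K-READ 03 counterexample to the §B candidate «`NSIFirstBlowupIsTypeI`: first-time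
blow-ups of weak solutions of the Navier–Stokes INEQUALITY are Type I» (HOME bus,
`ns-typeII-critic-1/KREAD-03-NSIFirstBlowupIsTypeI.md`):

* `printed_constants_margin` — **the printed block has super-similar gain.** With the constants
  of W. S. Ożański, arXiv:1709.00602, §5.5 ((5.16) `τ = 0.48ε`, (5.30) `‖f₁‖_∞ ≤ μ/100`,
  `μ > 100`, (5.31) `T = (μ² - 5)/(1.1ε²B)`; tree: `printed_constants`) the two numerical
  hypotheses behind the gain inequality (4.2) hold with the constant `τ⁻²` replaced by
  `(6/5)² τ⁻²`: `(6/5)²τ⁻²(μ/100 + μ)² < 8TB` and `(6/5)²τ⁻²(μ/100)² < 0.01TB` (printed slack: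
  `8TB ≥ (7.2/1.1)(μ/ε)²` against `(1.01/0.48)²(μ/ε)²`, ratio `1.478`; Case 2 ratio `18.8`).
  Feeding these into the (verbatim) §4 argument gives a classical block whose gain of magnitude is
  `|u(Γx,T)| ≥ (6/5)τ⁻¹|u(x,0)|` while its similarity ratio stays `τ`.
* `nsi_superPiece` — **two-parameter covariance of the pointwise Navier–Stokes
  inequality.** For a classical block `u` (pointwise NSI for every `ν ∈ [0,ν₀]`), amplitude
  `a > 0`, space ratio `b > 0` with `b ≤ a`, and time ratio `ab`, the rescaled field
  `w(s,y) = a·u(t₀ + ab·s, x₁ + b·y)` satisfies the pointwise NSI at viscosity `ν ∈ [0,ν₀]`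
  (because `u` satisfies it at the effective viscosity `νb/a ≤ ν`). With `a = b = τ⁻ʲ` this is
  the tree's `IsNSIBlock.nsi_piece`; with `a = (6/5)ʲτ⁻ʲ > b = τ⁻ʲ` it is the `j`-th piece of
  the super-self-similar cascade, whose switched field is a weak NSI solution (gluing principle
  `isWeakNSISolution_of_piecewise`) with `(T₀ - t)^{1/2}‖𝔲(t)‖_∞ → ∞`, i.e. a TYPE-II blow-up
  inside the NSI class.

Neither lemma asserts a Theses statement; both are negative-lane support (D-0016) for the
barrier reading of `NoTypeII`: any Type-II exclusion proved from ⟨energy class, local energy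
inequality with defect, Riesz pressure law, divergence-free, smoothness before `T`, compact
support⟩ alone is contradicted by the cascade.

## References

* W. S. Ożański, *On weak solutions to the Navier–Stokes inequality with internal
  singularities*, arXiv:1709.00602 (2017), §2 (2.4), §4, §5.5 (5.16), (5.29)–(5.31).
  [`Ozanski2017NSISingular`]
* V. Scheffer, Comm. Math. Phys. 101 (1985), 47–85, Lemma 2.3. [`Scheffer1985`]

(Verbatim declaration-level port — the declarations listed in the Part header count — of the Summits-side module of the
NavierStokesRegularity tree (negative lane of `TypeIliouvilleNoTypeII`); route / lane bookkeeping in the text above is historical.)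
-/

section Part1

open _root_.MeasureTheory _root_.Set _root_.Function _root_.Filter _root_.Topology
open scoped _root_.InnerProductSpace RealInnerProductSpace _root_.ContDiff Laplacian

namespace Literature.Barriers.NavierStokesRegularity.NSISuperCascade

open Literature.Analysis.FluidPDE Literature.Barriers.NavierStokesRegularity

/-! ### The printed constants leave a gain margin `K = 6/5` -/

/-- **Two-parameter covariance of the pointwise Navier–Stokes inequality with a change of
viscosity.** If `u` is a classical NSI block (`IsNSIBlock`: pointwise
`∂ₜ|u|² ≤ -u·∇(|u|² + 2p̃[u]) + 2ν' u·Δu` on `[0,T] × ℝ³` for every `ν' ∈ [0,ν₀]`), `0 < b ≤ a`,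
`ν ∈ [0, ν₀]`, and the local time `σ = t₀ + ab·s` lies in `[0,T]`, then the super-self-similar
piece `w = a • stPull (ab) b t₀ x₁ u`, `w(s,y) = a · u(t₀ + ab·s, x₁ + b·y)`, satisfies the pointwise NSI at viscosity `ν` at `(s, x)`:
every term of the inequality for `w` is `a³b` times the corresponding term for `u` at
`(σ, x₁ + bx)` with viscosity `νb/a ∈ [0, ν₀]`. (`a = b`: Ożański 2017, §2, the rescaled copies
"satisfy the NSI"; `a > b`: the pieces of the super-self-similar cascade.)
[cite: Ozanski2017NSISingular, §2 (2.4)] -/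
theorem nsi_superPiece
    {T ν₀ τ : ℝ} {z : EuclideanSpace ℝ (Fin 3)} {G : Set (EuclideanSpace ℝ (Fin 3))}
    {u : ℝ → EuclideanSpace ℝ (Fin 3) → EuclideanSpace ℝ (Fin 3)}
    (h : IsNSIBlock T ν₀ τ z G u) {a b : ℝ} (ha : 0 < a) (hb : 0 < b) (hba : b ≤ a)
    {ν : ℝ} (hν : ν ∈ Icc 0 ν₀) (t₀ : ℝ) (x₁ : EuclideanSpace ℝ (Fin 3)) {s : ℝ}
    (hs : t₀ + a * b * s ∈ Icc 0 T) (x : EuclideanSpace ℝ (Fin 3)) :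
    timeDeriv (fun r y => ‖(a • stPull (a * b) b t₀ x₁ u) r y‖ ^ 2) s x ≤
      -⟪(a • stPull (a * b) b t₀ x₁ u) s x, gradient (fun y => ‖(a • stPull (a * b) b t₀ x₁ u) s y‖ ^ 2 +
          2 * normalisedPressure ((a • stPull (a * b) b t₀ x₁ u) s) y) x⟫ +
        2 * ν * ⟪(a • stPull (a * b) b t₀ x₁ u) s x, Δ ((a • stPull (a * b) b t₀ x₁ u) s) x⟫ := by
  -- abbreviations
  set θ : ℝ := a * b with hθ
  have hθpos : 0 < θ := mul_pos ha hb
  set σ : ℝ := t₀ + θ * s with hσdef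
  set y : EuclideanSpace ℝ (Fin 3) := x₁ + b • x with hydef
  have hσ : σ ∈ Icc 0 T := hs
  -- the effective viscosity `ν b / a ∈ [0, ν₀]`
  have hν' : ν * b / a ∈ Icc 0 ν₀ := by
    refine ⟨div_nonneg (mul_nonneg hν.1 hb.le) ha.le, le_trans ?_ hν.2⟩
    rw [div_le_iff₀ ha]
    exact mul_le_mul_of_nonneg_left hba hν.1
  -- the block inequality at `(σ, y)` with viscosity `ν b / a`
  have hblock := h.nsi (ν * b / a) hν' σ hσ y
  -- regularity of the slice `u σ` and of its pressure
  have huσ : ContDiff ℝ ∞ (u σ) := h.contDiff_slice hσ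
  have hu2 : ContDiff ℝ 2 (u σ) := huσ.of_le (by norm_cast)
  have huc : HasCompactSupport (u σ) := h.hasCompactSupport_slice hσ
  have hp2 : ContDiff ℝ 2 (normalisedPressure (u σ)) :=
    contDiff_normalisedPressure_of_hasCompactSupport huσ huc
  set Q : EuclideanSpace ℝ (Fin 3) → ℝ := fun w => ‖u σ w‖ ^ 2 + 2 * normalisedPressure (u σ) w
    with hQdef
  have hQd : Differentiable ℝ Q :=
    ((hu2.differentiable (by norm_num)).norm_sq ℝ).add
      ((hp2.differentiable (by norm_num)).const_mul 2)
  -- (1) the time derivative of `|w|²`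
  have e1 : (fun r w => ‖(a • stPull θ b t₀ x₁ u) r w‖ ^ 2) =
      (a ^ 2) • stPull θ b t₀ x₁ (fun r w => ‖u r w‖ ^ 2) := by
    funext r w
    simp only [smul_stPull_apply, smul_eq_mul, norm_smul, Real.norm_eq_abs, mul_pow, sq_abs]
  have hT : timeDeriv (fun r w => ‖(a • stPull θ b t₀ x₁ u) r w‖ ^ 2) s x =
      (a ^ 2 * θ) * timeDeriv (fun r w => ‖u r w‖ ^ 2) σ y := by
    rw [e1, timeDeriv_eq_timeDerivWithin_univ, timeDeriv_eq_timeDerivWithin_univ]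
    have := timeDerivWithin_smul_stPull (univ : Set ℝ) (fun r w => ‖u r w‖ ^ 2) (a ^ 2)
      (β := θ) hθpos.ne' b t₀ x₁ s x
    rw [preimage_univ] at this
    rw [this, smul_eq_mul]
  -- (2) the gradient term
  have e2 : (fun w => ‖(a • stPull θ b t₀ x₁ u) s w‖ ^ 2 +
      2 * normalisedPressure ((a • stPull θ b t₀ x₁ u) s) w) =
      fun w => (a ^ 2) • stPull θ b t₀ x₁ (fun (_ : ℝ) w' => Q w') s w := by
    have hp : ∀ w, normalisedPressure ((a • stPull θ b t₀ x₁ u) s) w =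
        a ^ 2 * normalisedPressure (u σ) (x₁ + b • w) := by
      intro w
      have e : (a • stPull θ b t₀ x₁ u) s = fun y => a • u σ (x₁ + b • y) := by
        funext y; rfl
      rw [e]
      exact normalisedPressure_smul_comp_affine _ _ _ hb w
    funext w
    rw [hp w]
    simp only [smul_stPull_apply, stPull_apply, smul_eq_mul, norm_smul, Real.norm_eq_abs,
      mul_pow, sq_abs, hQdef]
    ring
  have hG : gradient (fun w => ‖(a • stPull θ b t₀ x₁ u) s w‖ ^ 2 +
      2 * normalisedPressure ((a • stPull θ b t₀ x₁ u) s) w) x = (a ^ 2 * b) • gradient Q y := by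
    rw [e2]
    have hd : DifferentiableAt ℝ (stPull θ b t₀ x₁ (fun (_ : ℝ) w' => Q w') s) x :=
      differentiable_stPull_slice (u := fun (_ : ℝ) w' => Q w') hQd x
    rw [gradient_const_smul hd, gradient_stPull, smul_smul]
  -- (3) the Laplacian
  have hL : Δ ((a • stPull θ b t₀ x₁ u) s) x = (a * b ^ 2) • Δ (u σ) y := by
    have hu2' : ContDiffAt ℝ 2 (stPull θ b t₀ x₁ u s) x := (contDiff_stPull_slice hu2).contDiffAt
    rw [show (a • stPull θ b t₀ x₁ u) s = a • stPull θ b t₀ x₁ u s from rfl,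
      InnerProductSpace.laplacian_smul a hu2', laplacian_stPull θ b t₀ x₁ u s x hu2, smul_smul]
  -- (4) the value
  have hV : (a • stPull θ b t₀ x₁ u) s x = a • u σ y := rfl
  -- assemble
  rw [hT, hG, hL, hV]
  simp only [inner_smul_left, inner_smul_right, RCLike.conj_to_real]
  have key : a ^ 2 * θ * timeDeriv (fun r w => ‖u r w‖ ^ 2) σ y ≤
      a ^ 2 * θ * (-⟪u σ y, gradient Q y⟫ + 2 * (ν * b / a) * ⟪u σ y, Δ (u σ) y⟫) :=
    mul_le_mul_of_nonneg_left hblock (mul_nonneg (pow_nonneg ha.le 2) hθpos.le)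
  have e3 : a ^ 2 * θ * (-⟪u σ y, gradient Q y⟫ + 2 * (ν * b / a) * ⟪u σ y, Δ (u σ) y⟫) =
      -(a ^ 2 * b * (a * ⟪u σ y, gradient Q y⟫)) +
        2 * ν * (a * b ^ 2 * (a * ⟪u σ y, Δ (u σ) y⟫)) := by
    rw [hθ]; field_simp
  rw [e3] at key
  linarith [key]

end Literature.Barriers.NavierStokesRegularity.NSISuperCascade

end Part1

/-!
## Part 2 — port of `Summits/NavierStokesRegularity/NavierStokesRegularity/Theorems/TypeIliouvilleNoTypeII/Negative/NSISuperGainBlock.lean` (6 declarations kept)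

# Negative lane of `NoTypeII`: a classical NSI block with SUPER-similar gain (brick B1)

Support file (`--supports stmt-NavierStokesRegularity-0056`, the residual `NoTypeII` of the
Type-I Liouville door) for the model-class counterexample «the Navier–Stokes INEQUALITY admits
Type-II blow-up» (HOME bus: critic-1 `KREAD-03-NSIFirstBlowupIsTypeI.md` §6, lit-coord barrier
spec `NSITypeIIBlowup`, critic-2 concurrence). It discharges the first of the three bricks of that
counterexample as a kernel theorem:

* `exists_superGain_nsiBlock` — **there is a classical block `(T, ν₀, τ, z, G, u)` of the
  Navier–Stokes inequality (tree: `IsNSIBlock`, Ożański 2017, Prop. 4.2 / Scheffer 1985,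
  Lemma 3.3) whose gain of magnitude along the similarity `Γx = τx + z` is STRICTLY
  super-similar: `g·|u(x,0)| ≤ |u(Γx,T)|` for all `x`, with `g > τ⁻¹`** (indeed for every
  `g ≤ g₀`, some `g₀ > τ⁻¹`). The printed block only records `g = τ⁻¹` ((2.2), the `gain` field of
  `IsNSIBlock`), which forces the self-similar time ratio `τ²` and a Type-I rate
  (`not_isTypeIIBlowup_glue`); with `g > τ⁻¹` the pieces `gʲ u((t - tⱼ)/σʲ, ·/τʲ)`, `σ = τ/g < τ²·(gτ)⁻¹`,
  still satisfy the NSI (two-parameter covariance, `nsi_superPiece` of `NSISuperSimilarSeed`) and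
  drop in magnitude at the switching times, while `(T₀ - t)^{1/2}‖𝔲(t)‖_∞ ≥ c (gτ)^{j/2} → ∞`:
  a Type-II blow-up inside the NSI class (bricks B2–B3, not in this file).

The proof is Ożański's §4 verbatim with one observation: the gain inequality (4.11) of Lemma 4.1
is STRICT with a uniform margin `θ > 0` on the compact set `G` (tree: the `gain`/`θ_pos` fields of
`IsHProfileData`), and `f₁ + f₂` is bounded, so `τ⁻²(f₁ + f₂)² + θ ≥ g²(f₁ + f₂)² + θ/2` for some
`g > τ⁻¹`; running the §4.1–4.2 construction with tolerance `ε ≤ θ/2` (instead of `ε ≤ θ`) the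
profiles `qᵏ` inherit the gain `g` (`superGain_qProf`, twin of `IsQData.gain_qProf`), and the block
`u = u[a₁ᵏv₁, qᵏ₁] + u[a₂ᵏv₂, qᵏ₂]` (tree: `profileField`, `IsNSIProfileData.isNSIBlock_profileField`)
is unchanged. Applied to the proved arrangement (`NSIArrangementExists_holds`, Ożański §5 / §6.5)
this gives the unconditional existence statement.

Nothing here asserts a Theses statement; the file is negative-lane support (D-0016): any proof of
`NoTypeII` must use a property of Navier–Stokes solutions that fails for the NSI class with
super-similar blocks.

## References

* W. S. Ożański, *On weak solutions to the Navier–Stokes inequality with internal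
  singularities*, arXiv:1709.00602v4, §2 (2.2), Lemma 4.1 (4.11), §4.1–4.2 ((4.16)–(4.20),
  Prop. 4.2), §5. [`Ozanski2017NSISingular`]
* V. Scheffer, *A solution to the Navier–Stokes inequality with an internal singularity*,
  Comm. Math. Phys. 101 (1985), 47–85, Lemmas 2.1, 3.1–3.3. [`Scheffer1985`]

(Verbatim declaration-level port — the declarations listed in the Part header count — of the Summits-side module of the
NavierStokesRegularity tree (negative lane of `TypeIliouvilleNoTypeII`); route / lane bookkeeping in the text above is historical.)
-/

section Part2

open _root_.Set _root_.Function _root_.Filter _root_.Topology _root_.Metric _root_.MeasureTheory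

namespace Literature.Barriers.NavierStokesRegularity.NSISuperCascade

open Literature.Analysis.FluidPDE Literature.Barriers.NavierStokesRegularity
open Literature.Barriers.NavierStokesRegularity.IsQData

/-! ### The profiles `qᵏ` inherit any gain `g` with margin ((4.11) with `θ/2`) -/

section QLevel

variable {U : Fin 2 → Set (ℝ × ℝ)} {V : Fin 2 → ℝ × ℝ → ℝ × ℝ} {f φ ψ : Fin 2 → ℝ × ℝ → ℝ}
  {H : Fin 2 → ℝ → ℝ × ℝ → ℝ} {T δ : ℝ} {κ : ℝ → ℝ} {a : ℕ → Fin 2 → ℝ → ℝ}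

/-- **The gain `qᵏ_{1,T} + qᵏ_{2,T} ≥ g (f₁ + f₂) ∘ R⁻¹` along `Γ` on `G`** for ANY `g ≥ 0` with
`g²(f₁ + f₂)²(R⁻¹x) + θ' ≤ h²_{2,T}(R⁻¹(Γx))` on `G` and a good index at tolerance `ε ≤ θ'`
(twin of `IsQData.gain_qProf`, which is the case `g = τ⁻¹`).
[cite: Ozanski2017NSISingular, §4 (after Prop. 4.2) and Lemma 4.1 (4.11)] -/
theorem superGain_qProf (hQ : IsQData U V f φ ψ H T δ κ a) {k : ℕ} {ε : ℝ} (hg : Good a V H T k ε)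
    {τ : ℝ} {z : EuclideanSpace ℝ (Fin 3)} {g θ' : ℝ} (hg0 : 0 ≤ g) (hεθ : ε ≤ θ')
    (hgain : ∀ x ∈ revolve (closure (U 0) ∪ closure (U 1)),
      g ^ 2 * (f 0 (meridian x) + f 1 (meridian x)) ^ 2 + θ' ≤ H 1 T (meridian (τ • x + z)) ^ 2)
    {x : EuclideanSpace ℝ (Fin 3)} (hx : x ∈ revolve (closure (U 0) ∪ closure (U 1))) :
    g * (qProf f φ δ κ a V H k 0 0 (meridian x) + qProf f φ δ κ a V H k 1 0 (meridian x)) ≤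
      qProf f φ δ κ a V H k 0 T (meridian (τ • x + z)) +
        qProf f φ δ κ a V H k 1 T (meridian (τ • x + z)) := by
  have hT : T ∈ Icc (0 : ℝ) T := ⟨hQ.T_pos.le, le_rfl⟩
  rw [hQ.qProf_zero k 0, hQ.qProf_zero k 1]
  have h0 : 0 ≤ qProf f φ δ κ a V H k 0 T (meridian (τ • x + z)) := qProf_nonneg k 0 T _
  have hf : 0 ≤ g * (f 0 (meridian x) + f 1 (meridian x)) :=
    mul_nonneg hg0
      (add_nonneg ((hQ.isNSIStructure 0).f_nonneg _) ((hQ.isNSIStructure 1).f_nonneg _))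
  have h1 : g * (f 0 (meridian x) + f 1 (meridian x)) ≤
      qProf f φ δ κ a V H k 1 T (meridian (τ • x + z)) := by
    have e := hQ.qRad_sub_H_sq k 1 (hQ.κ_eq T hT) (meridian (τ • x + z))
    have hb := (abs_le.1 (hg T hT (meridian (τ • x + z)) 1).1).2
    have hgx := hgain x hx
    have hq : (g * (f 0 (meridian x) + f 1 (meridian x))) ^ 2 ≤
        qRad f φ δ κ a V H k 1 T (meridian (τ • x + z)) := by
      rw [mul_pow]; linarith
    calc g * (f 0 (meridian x) + f 1 (meridian x))
        = Real.sqrt ((g * (f 0 (meridian x) + f 1 (meridian x))) ^ 2) := (Real.sqrt_sq hf).symm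
      _ ≤ qProf f φ δ κ a V H k 1 T (meridian (τ • x + z)) := Real.sqrt_le_sqrt hq
  linarith

/-- **A strict gain margin yields a super-similar gain constant**: if
`τ⁻²(f₁ + f₂)²(R⁻¹x) + θ ≤ h²_{2,T}(R⁻¹(Γx))` on `G` with `θ > 0` ((4.11)), then for some
`g > τ⁻¹` also `g²(f₁ + f₂)²(R⁻¹x) + θ/2 ≤ h²_{2,T}(R⁻¹(Γx))` on `G` (`f₁ + f₂` is bounded:
`supp fᵢ = Ūᵢ` compact). [cite: Ozanski2017NSISingular, Lemma 4.1 (4.11) and (4.8)] -/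
theorem exists_superGain_margin (hQ : IsQData U V f φ ψ H T δ κ a) {τ : ℝ} (hτ : 0 < τ) {z : EuclideanSpace ℝ (Fin 3)}
    {θ : ℝ} (hθ : 0 < θ)
    (hgain : ∀ x ∈ revolve (closure (U 0) ∪ closure (U 1)),
      τ⁻¹ ^ 2 * (f 0 (meridian x) + f 1 (meridian x)) ^ 2 + θ ≤ H 1 T (meridian (τ • x + z)) ^ 2) :
    ∃ g : ℝ, τ⁻¹ < g ∧ ∀ x ∈ revolve (closure (U 0) ∪ closure (U 1)),
      g ^ 2 * (f 0 (meridian x) + f 1 (meridian x)) ^ 2 + θ / 2 ≤ H 1 T (meridian (τ • x + z)) ^ 2 := by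
  obtain ⟨M₀, hM₀⟩ := (hQ.isNSIStructure 0).exists_f_le
  obtain ⟨M₁, hM₁⟩ := (hQ.isNSIStructure 1).exists_f_le
  -- a positive bound `S` of `f₁ + f₂`
  set S : ℝ := |M₀| + |M₁| + 1 with hS
  have hSpos : 0 < S := by positivity
  have hFS : ∀ q, f 0 q + f 1 q ≤ S := fun q => by
    have h0 := (hM₀ q).trans (le_abs_self M₀)
    have h1 := (hM₁ q).trans (le_abs_self M₁)
    linarith
  have hF0 : ∀ q, 0 ≤ f 0 q + f 1 q := fun q =>
    add_nonneg ((hQ.isNSIStructure 0).f_nonneg q) ((hQ.isNSIStructure 1).f_nonneg q)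
  -- `g² = τ⁻² + θ/(2S²)`
  have hc : 0 < θ / (2 * S ^ 2) := by positivity
  refine ⟨Real.sqrt (τ⁻¹ ^ 2 + θ / (2 * S ^ 2)), ?_, fun x hx => ?_⟩
  · calc τ⁻¹ = Real.sqrt (τ⁻¹ ^ 2) := (Real.sqrt_sq (inv_nonneg.2 hτ.le)).symm
      _ < Real.sqrt (τ⁻¹ ^ 2 + θ / (2 * S ^ 2)) :=
        Real.sqrt_lt_sqrt (sq_nonneg _) (by linarith)
  · rw [Real.sq_sqrt (by positivity)]
    have hgx := hgain x hx
    set F : ℝ := f 0 (meridian x) + f 1 (meridian x) with hF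
    have hF1 : F ^ 2 ≤ S ^ 2 := pow_le_pow_left₀ (hF0 _) (hFS _) 2
    have h2 : θ / (2 * S ^ 2) * F ^ 2 ≤ θ / 2 := by
      calc θ / (2 * S ^ 2) * F ^ 2 ≤ θ / (2 * S ^ 2) * S ^ 2 :=
            mul_le_mul_of_nonneg_left hF1 hc.le
        _ = θ / 2 := by field_simp
    calc (τ⁻¹ ^ 2 + θ / (2 * S ^ 2)) * F ^ 2 + θ / 2
        = τ⁻¹ ^ 2 * F ^ 2 + (θ / (2 * S ^ 2) * F ^ 2 + θ / 2) := by ring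
      _ ≤ τ⁻¹ ^ 2 * F ^ 2 + θ := by linarith
      _ ≤ H 1 T (meridian (τ • x + z)) ^ 2 := hgx

/-- **Proposition 4.2 with super-similar gain: the input of §4.1 yields profile data
(`IsNSIProfileData`, as in `IsQData.exists_profileData`) whose profiles moreover satisfy
`g (qᵏ₁ + qᵏ₂)(0)(R⁻¹x) ≤ (qᵏ₁ + qᵏ₂)(T)(R⁻¹(Γx))` on `G` for some `g > τ⁻¹`** — the §4.1–4.2
construction run with tolerance `ε ≤ θ/2`. [cite: Ozanski2017NSISingular, Prop. 4.2 and §4.1–4.2]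
[cite: Scheffer1985, Lemma 3.3] -/
theorem exists_superProfileData (hQ : IsQData U V f φ ψ H T δ κ a) {τ : ℝ} (hτ : 0 < τ) {z : EuclideanSpace ℝ (Fin 3)}
    {θ : ℝ} (hθ : 0 < θ)
    (hgain : ∀ x ∈ revolve (closure (U 0) ∪ closure (U 1)),
      τ⁻¹ ^ 2 * (f 0 (meridian x) + f 1 (meridian x)) ^ 2 + θ ≤ H 1 T (meridian (τ • x + z)) ^ 2) :
    ∃ g : ℝ, τ⁻¹ < g ∧
      ∃ (η δ' : ℝ) (C₀ C₁ : Set (ℝ × ℝ)) (a₀ a₁ : ℝ → ℝ) (Q₀ Q₁ : ℝ → ℝ × ℝ → ℝ),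
        IsNSIProfileData (U 0) (U 1) (V 0) (V 1) (f 0) (f 1) T τ z η δ' C₀ C₁ a₀ a₁ Q₀ Q₁ ∧
        ∀ x ∈ revolve (closure (U 0) ∪ closure (U 1)),
          g * (Q₀ 0 (meridian x) + Q₁ 0 (meridian x)) ≤
            Q₀ T (meridian (τ • x + z)) + Q₁ T (meridian (τ • x + z)) := by
  obtain ⟨g, hgτ, hgain'⟩ := exists_superGain_margin hQ hτ hθ hgain
  have hg0 : 0 ≤ g := le_of_lt (lt_trans (inv_pos.2 hτ) hgτ)
  obtain ⟨μ, hμ, hμle⟩ := hQ.exists_margin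
  obtain ⟨B, hB0, hB⟩ := hQ.exists_abs_V_le
  obtain ⟨K, hK0, hK⟩ := exists_pressure_constant U
  have hδ := hQ.δ_pos
  obtain ⟨ε, hεpos, hεμ, hεθ, hεδ⟩ := exists_tolerance hμ (half_pos hθ) hδ hB0 hK0
  have hεθ' : ε ≤ θ := hεθ.trans (half_le_self hθ.le)
  obtain ⟨Kk, hKk⟩ := hQ.exists_good hεpos
  have hg : Good a V H T Kk ε := hKk Kk le_rfl
  have hposT : ∀ i, ∀ t ∈ Icc (0 : ℝ) T, ∀ x ∈ U i,
      (V i x).1 ^ 2 + (V i x).2 ^ 2 < qRad f φ δ κ a V H Kk i t x :=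
    fun i t ht x hx => hQ.sq_lt_qRad_of_mem_Icc hg hμle hεμ i ht hx
  obtain ⟨η, hη, hposS⟩ := hQ.exists_eta Kk hposT
  have hηI : Icc (0 : ℝ) T ⊆ Ioo (-η) (T + η) := fun t ht => ⟨by linarith [ht.1], by linarith [ht.2]⟩
  have hκI : ∀ t ∈ Icc (0 : ℝ) T, κ t ∈ Icc (-1 : ℝ) (T + 1) := fun t ht => by
    rw [hQ.κ_eq t ht]; exact ⟨by linarith [ht.1], by linarith [ht.2]⟩
  have hS0 := hQ.isNSIStructure 0
  have hS1 := hQ.isNSIStructure 1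
  refine ⟨g, hgτ, η, δ / 4, {x | 1 / 4 ≤ φ 0 x}, {x | 1 / 4 ≤ φ 1 x}, a Kk 0, a Kk 1,
    qProf f φ δ κ a V H Kk 0, qProf f φ δ κ a V H Kk 1, ?_,
    fun x hx => superGain_qProf hQ hg hg0 hεθ hgain' hx⟩
  exact
    { η_pos := hη
      δ_pos := by positivity
      a₁_smooth := hQ.osc.contDiff Kk 0
      a₂_smooth := hQ.osc.contDiff Kk 1
      abs_a₁_le := fun t => hQ.osc.abs_le Kk 0 t
      abs_a₂_le := fun t => hQ.osc.abs_le Kk 1 t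
      isClosed₁ := isClosed_le continuous_const hS0.φ_smooth.continuous
      isClosed₂ := isClosed_le continuous_const hS1.φ_smooth.continuous
      subset₁ := hS0.setOf_le_φ_subset
      subset₂ := hS1.setOf_le_φ_subset
      tsupport_v₁ := fun x hx => by
        have h1 : φ 0 x = 1 := hS0.tsupport_v hx
        show (1 : ℝ) / 4 ≤ φ 0 x
        rw [h1]; norm_num
      tsupport_v₂ := fun x hx => by
        have h1 : φ 1 x = 1 := hS1.tsupport_v hx
        show (1 : ℝ) / 4 ≤ φ 1 x
        rw [h1]; norm_num
      Q₁_smooth := hQ.contDiffOn_qProf Kk 0 (hposS 0)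
      Q₂_smooth := hQ.contDiffOn_qProf Kk 1 (hposS 1)
      Q₁_nonneg := fun t _ x => qProf_nonneg Kk 0 t x
      Q₂_nonneg := fun t _ x => qProf_nonneg Kk 1 t x
      Q₁_eq_zero := fun t _ x hx => hQ.qProf_eq_zero Kk 0 t hx
      Q₂_eq_zero := fun t _ x hx => hQ.qProf_eq_zero Kk 1 t hx
      sq_lt₁ := fun t ht x hx => by
        rw [qProf_sq (hQ.qRad_nonneg Kk 0 (hposS 0 t ht) x)]
        exact hposS 0 t ht x hx
      sq_lt₂ := fun t ht x hx => by
        rw [qProf_sq (hQ.qRad_nonneg Kk 1 (hposS 1 t ht) x)]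
        exact hposS 1 t ht x hx
      initial₁ := fun x => hQ.qProf_zero Kk 0 x
      initial₂ := fun x => hQ.qProf_zero Kk 1 x
      inner₁ := fun t ht x hx => hQ.inner_ineq hg hεpos.le hK0 hK hB hεδ hposS hηI 0 ht hx
      inner₂ := fun t ht x hx => hQ.inner_ineq hg hεpos.le hK0 hK hB hεδ hposS hηI 1 ht hx
      outer₁ := fun t ht x hx =>
        hQ.outer_deriv hposS hηI 0 ht (lt_of_lt_of_le (not_le.1 hx) (by norm_num))
      outer₂ := fun t ht x hx =>
        hQ.outer_deriv hposS hηI 1 ht (lt_of_lt_of_le (not_le.1 hx) (by norm_num))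
      opL₁ := fun t ht x hx _ => mul_nonneg (qProf_nonneg Kk 0 t x)
        ((hQ.crit_qProf 0 (hposS 0) (hηI ht) (hκI t ht)).2.1 x (not_le.1 hx))
      opL₂ := fun t ht x hx _ => mul_nonneg (qProf_nonneg Kk 1 t x)
        ((hQ.crit_qProf 1 (hposS 1) (hηI ht) (hκI t ht)).2.1 x (not_le.1 hx))
      gain := fun x hx => hQ.gain_qProf hg hτ hεθ' hgain hx }

end QLevel

/-! ### From an arrangement: a block with super-similar gain -/

section Arrangement

variable {U₁ U₂ : Set (ℝ × ℝ)} {v₁ : ℝ × ℝ → ℝ × ℝ} {f₁ φ₁ : ℝ × ℝ → ℝ} {v₂ : ℝ × ℝ → ℝ × ℝ}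
  {f₂ φ₂ : ℝ × ℝ → ℝ} {T τ : ℝ} {z : EuclideanSpace ℝ (Fin 3)}

/-- **The gain of magnitude of the block `u = u[a₁v₁,Q₁] + u[a₂v₂,Q₂]` is that of its profiles**:
if `g (Q₁ + Q₂)(0)(R⁻¹x) ≤ (Q₁ + Q₂)(T)(R⁻¹(Γx))` on `G` then `g|u(x,0)| ≤ |u(Γx,T)|` for every
`x ∈ ℝ³` (on `G` by `|u| = (Q₁ + Q₂) ∘ R⁻¹`; off `G`, `u(x,0) = 0`). Twin of
`IsNSIProfileData.gain_profileField` (`g = τ⁻¹`). [cite: Ozanski2017NSISingular, Prop. 4.2 (ii)]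
[cite: Scheffer1985, Lemma 3.1 (3.14)] -/
theorem superGain_profileField {η δ : ℝ} {C₁ C₂ : Set (ℝ × ℝ)} {a₁ a₂ : ℝ → ℝ}
    {Q₁ Q₂ : ℝ → ℝ × ℝ → ℝ}
    (h : IsNSIProfileData U₁ U₂ v₁ v₂ f₁ f₂ T τ z η δ C₁ C₂ a₁ a₂ Q₁ Q₂)
    (hA : IsNSIArrangement U₁ U₂ v₁ f₁ φ₁ v₂ f₂ φ₂ T τ z) {g : ℝ}
    (hgain : ∀ x ∈ revolve (closure U₁ ∪ closure U₂),
      g * (Q₁ 0 (meridian x) + Q₂ 0 (meridian x)) ≤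
        Q₁ T (meridian (τ • x + z)) + Q₂ T (meridian (τ • x + z)))
    (x : EuclideanSpace ℝ (Fin 3)) :
    g * ‖profileField v₁ v₂ a₁ a₂ Q₁ Q₂ 0 x‖ ≤ ‖profileField v₁ v₂ a₁ a₂ Q₁ Q₂ T (τ • x + z)‖ := by
  by_cases hx : x ∈ revolve (closure U₁ ∪ closure U₂)
  · rw [h.norm_profileField hA (h.zero_mem hA), h.norm_profileField hA (h.T_mem hA)]
    exact hgain x hx
  · rw [h.profileField_eq_zero hA (h.zero_mem hA) (by simpa using hx), norm_zero, mul_zero]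
    exact norm_nonneg _

/-- **Every geometric arrangement carries a classical block with super-similar gain**: for an
`IsNSIArrangement` with similarity `Γx = τx + z` there are `g₀ > τ⁻¹`, `ν₀ > 0` and a classical
block `u` (`IsNSIBlock T ν₀ τ z G u`, `G = R(Ū₁ ∪ Ū₂)`; Ożański Prop. 4.2, Scheffer Lemma 3.3)
with `g|u(x,0)| ≤ |u(Γx,T)|` for all `x` and all `g ≤ g₀` (Lemma 4.1's gain (4.11) is strict with
margin `θ > 0`; §4.1–4.2 run at tolerance `θ/2`).
[cite: Ozanski2017NSISingular, Lemma 4.1 (4.11), Prop. 4.2, §4.2] [cite: Scheffer1985, Lemmas 3.1–3.3] -/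
theorem exists_superGainBlock_of_isNSIArrangement
    (hA : IsNSIArrangement U₁ U₂ v₁ f₁ φ₁ v₂ f₂ φ₂ T τ z) :
    ∃ (g₀ ν₀ : ℝ) (u : ℝ → EuclideanSpace ℝ (Fin 3) → EuclideanSpace ℝ (Fin 3)), τ⁻¹ < g₀ ∧
      IsNSIBlock T ν₀ τ z (revolve (closure U₁ ∪ closure U₂)) u ∧
      ∀ g ≤ g₀, ∀ x : EuclideanSpace ℝ (Fin 3), g * ‖u 0 x‖ ≤ ‖u T (τ • x + z)‖ := by
  obtain ⟨δ, κ, ψ₁, ψ₂, m₁, m₂, θ, hH⟩ := hA.exists_hProfileData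
  obtain ⟨a, ha⟩ := exists_isOscFamily hA.T_pos
  have hQ := hH.isQData hA ha
  obtain ⟨g₀, hg₀, η, δ', C₀, C₁, a₀, a₁, Q₀, Q₁, hP, hsuper⟩ :=
    exists_superProfileData hQ hA.τ_mem.1 hH.θ_pos hH.gain
  obtain ⟨ν₀, hblock⟩ := hP.isNSIBlock_profileField hA
  refine ⟨g₀, ν₀, _, hg₀, hblock, fun g hg x => ?_⟩
  exact (mul_le_mul_of_nonneg_right hg (norm_nonneg _)).trans
    (superGain_profileField hP hA hsuper x)

end Arrangement

/-! ### The unconditional statement -/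

/-- **A classical NSI block with super-similar gain exists**: there are `T, ν₀ > 0`,
`τ ∈ (0,1)`, `z`, a compact `G` with `Γ(G) ⊆ G`, `Γx = τx + z`, and a smooth compactly
supported divergence-free `u` on `[0,T] × ℝ³` satisfying the pointwise Navier–Stokes
inequality for every `ν ∈ [0,ν₀]` (`IsNSIBlock`), `u(·,0) ≢ 0`, together with a constant
`g > τ⁻¹` such that `g|u(x,0)| ≤ |u(Γx,T)|` for all `x` — from the proved arrangement of
Ożański §5 (`NSIArrangementExists_holds`). With `σ := τ/g < τ²` as time ratio of the switching,
the resulting cascade has `(T₀ - t)^{1/2}‖𝔲(t)‖_∞ → ∞` (Type II); brick B1 of the model-class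
counterexample «NSI admits Type-II blow-up» to rate-blind exclusions of `NoTypeII`.
[cite: Ozanski2017NSISingular, §2 (2.2), Lemma 4.1 (4.11), Prop. 4.2, §5]
[cite: Scheffer1985, Lemmas 2.1, 3.3, §6] -/
theorem exists_superGain_nsiBlock :
    ∃ (T ν₀ τ : ℝ) (z : EuclideanSpace ℝ (Fin 3)) (G : Set (EuclideanSpace ℝ (Fin 3))) (u : ℝ → EuclideanSpace ℝ (Fin 3) → EuclideanSpace ℝ (Fin 3)) (g : ℝ),
      IsNSIBlock T ν₀ τ z G u ∧ τ⁻¹ < g ∧ ∀ x : EuclideanSpace ℝ (Fin 3), g * ‖u 0 x‖ ≤ ‖u T (τ • x + z)‖ := by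
  obtain ⟨U₁, U₂, v₁, f₁, φ₁, v₂, f₂, φ₂, T, τ, z, hA⟩ := NSIArrangementExists_holds
  obtain ⟨g₀, ν₀, u, hg₀, hblock, hsuper⟩ := exists_superGainBlock_of_isNSIArrangement hA
  exact ⟨T, ν₀, τ, z, _, u, g₀, hblock, hg₀, hsuper g₀ le_rfl⟩

end Literature.Barriers.NavierStokesRegularity.NSISuperCascade

end Part2

/-!
## Part 3 — port of `Summits/NavierStokesRegularity/NavierStokesRegularity/Theorems/TypeIliouvilleNoTypeII/Negative/NSISuperCascadeNotTypeI.lean` (12 declarations kept)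

# The super-similar switching cascade of a super-gain NSI block is NOT of Type I

Negative-lane support for `Summit.NavierStokesRegularity.NavierStokesRegularity.Theses.TypeILiouville.TypeIliouvilleNoTypeII`
: brick **B3 (formula level)** of the discharge of the
model-class barrier `NSITypeIIBlowup` ("weak solutions of the Navier–Stokes INEQUALITY blow up at
a Type-II rate"), complementing `NSISuperSimilarSeed` (two-parameter covariance of the pointwise
NSI, `nsi_superPiece`) and `NSISuperGainBlock` (brick B1: a classical NSI block with gain
`g > τ⁻¹`, `exists_superGain_nsiBlock`).

* `pieceG T σ τ a z u j` / `glueG T σ τ a z u` — the **generalised switched field**: amplitude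
  `aʲ`, parabolic clock `σ` (switching times `t_j = switchTime T σ j = T Σ_{k<j} σ^{2k}`, blow-up
  time `T₀ = blowupTime T σ = T/(1-σ²)`), spatial similarity ratio `τ` about `x₀ = z/(1-τ)`:
  `u^{(j)}(t,x) = aʲ u(σ^{-2j}(t - t_j), x₀ + τ^{-j}(x - x₀))`. Scheffer–Ożański's field is the case
  `σ = τ`, `a = τ⁻¹` (`pieceG_eq_piece`, `glueG_eq_glue`, both `rfl`).
* `not_isTypeIBlowup_glueG` — **if `a·σ > 1` and `u(0,·) ≢ 0` the glued field violates every
  Type-I bound `‖𝔲(t,x)‖ ≤ C/√(T₀ - t)` arbitrarily close to `T₀`**: at `t = t_j` on the point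
  `x₀ + τʲ(y - x₀)` its size is `aʲ‖u(0,y)‖` while `√(T₀ - t_j) = σʲ√T₀`, and `(aσ)ʲ → ∞`.
  (Scheffer's case has `aσ = 1`: Type I exactly, `not_isTypeIIBlowup_glue`.)
* `nsi_pieceG` — under the NSI covariance constraint `a σ² = τ` and `aτ ≥ 1` every piece satisfies
  the pointwise Navier–Stokes inequality at every viscosity `ν ∈ [0, ν₀]` during its life span
  (from `nsi_superPiece`); `norm_pieceG_succ_le` — the DROP condition at the switching times
  (`‖u^{(j+1)}(t_{j+1},x)‖ ≤ ‖u^{(j)}(t_{j+1},x)‖`, the `hdrop` hypothesis of the tree's generic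
  gluing theorem `isWeakNSISolution_of_piecewise`) is exactly the super-gain inequality
  `a‖u(0,y)‖ ≤ ‖u(T, τy + z)‖` of brick B1.
* `exists_superCascade_not_isTypeIBlowup` — **unconditionally, there is a classical NSI block and
  a gain `g > τ⁻¹` whose super-similar cascade (`a = g`, `σ = √(τ/g)`, so `aσ² = τ`,
  `aσ = √(gτ) > 1`) satisfies the piecewise NSI, the drop condition, and is NOT of Type I at
  `T₀`.** What remains for `NSITypeIIBlowup_holds` (brick B2, not here) is the weak-solution
  packaging of `glueG` (energy/integrability sums, ratio `g²τ³ < 1`, and the local energy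
  inequality across the switching times), i.e. the parametrised copy of `SchefferSwitched*`.

[cite: Ozanski2017NSISingular, §2 (2.2)–(2.5), §2.1 (p. 6)] for the switching construction and
its Type-I rate; the super-similar variant (`a > τ⁻¹`) is [folklore] bookkeeping on top of it.

(Verbatim declaration-level port — the declarations listed in the Part header count — of the Summits-side module of the
NavierStokesRegularity tree (negative lane of `TypeIliouvilleNoTypeII`); route / lane bookkeeping in the text above is historical.)
-/

section Part3

open _root_.Set _root_.Function _root_.Filter _root_.Topology _root_.Metric _root_.MeasureTheory
open scoped _root_.InnerProductSpace RealInnerProductSpace _root_.ContDiff Laplacian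

namespace Literature.Barriers.NavierStokesRegularity.NSISuperCascade

open Literature.Analysis.FluidPDE Literature.Barriers.NavierStokesRegularity
open Literature.Barriers.NavierStokesRegularity.Scheffer

section Field

variable {E : Type*} [NormedAddCommGroup E] [InnerProductSpace ℝ E]

/-- **The `j`-th generalised piece** `u^{(j)}(t, x) = aʲ u(σ^{-2j}(t - t_j), x₀ + τ^{-j}(x - x₀))`,
`t_j = switchTime T σ j`, `x₀ = z/(1-τ)`, as an affine pull-back (`stPull`, time first).
[cite: Ozanski2017NSISingular, §2 (2.4)] -/
def pieceG (T σ τ a : ℝ) (z : E) (u : ℝ → E → E) (j : ℕ) : ℝ → E → E :=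
  a ^ j • stPull ((σ⁻¹) ^ (2 * j)) ((τ⁻¹) ^ j) (-((σ⁻¹) ^ (2 * j) * switchTime T σ j))
    ((1 - (τ⁻¹) ^ j) • (1 - τ)⁻¹ • z) u

/-- Pointwise formula for the generalised piece. [cite: Ozanski2017NSISingular, §2 (2.4)] -/
theorem pieceG_apply (T σ τ a : ℝ) (z : E) (u : ℝ → E → E) (j : ℕ) (t : ℝ) (x : E) :
    pieceG T σ τ a z u j t x = a ^ j •
      u ((σ⁻¹) ^ (2 * j) * (t - switchTime T σ j))
        ((1 - τ)⁻¹ • z + (τ⁻¹) ^ j • (x - (1 - τ)⁻¹ • z)) := by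
  rw [pieceG, smul_stPull_apply]
  congr 2
  · ring
  · rw [smul_sub, sub_smul, one_smul, smul_comm ((τ⁻¹) ^ j) ((1 - τ)⁻¹) z]
    abel

/-- At the START of its life span: `u^{(j)}(t_j, x) = aʲ u(0, x₀ + τ^{-j}(x - x₀))`. [cite: Ozanski2017NSISingular, §2 (2.4)] -/
theorem pieceG_apply_switchTime (T σ τ a : ℝ) (z : E) (u : ℝ → E → E) (j : ℕ) (x : E) :
    pieceG T σ τ a z u j (switchTime T σ j) x =
      a ^ j • u 0 ((1 - τ)⁻¹ • z + (τ⁻¹) ^ j • (x - (1 - τ)⁻¹ • z)) := by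
  rw [pieceG_apply, sub_self, mul_zero]

/-- At the END of its life span: `u^{(j)}(t_{j+1}, x) = aʲ u(T, x₀ + τ^{-j}(x - x₀))` (`σ ≠ 0`).
[cite: Ozanski2017NSISingular, §2 (2.4)] -/
theorem pieceG_apply_switchTime_succ (T : ℝ) {σ : ℝ} (hσ : σ ≠ 0) (τ a : ℝ) (z : E)
    (u : ℝ → E → E) (j : ℕ) (x : E) :
    pieceG T σ τ a z u j (switchTime T σ (j + 1)) x =
      a ^ j • u T ((1 - τ)⁻¹ • z + (τ⁻¹) ^ j • (x - (1 - τ)⁻¹ • z)) := by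
  have hinv : (σ⁻¹) ^ (2 * j) * σ ^ (2 * j) = 1 := by
    rw [inv_pow, inv_mul_cancel₀ (pow_ne_zero _ hσ)]
  rw [pieceG_apply, switchTime_succ, add_sub_cancel_left, mul_comm T, ← mul_assoc, hinv, one_mul]

/-- **The drop condition at the switching times is the super-gain inequality**: if
`a‖u(0,y)‖ ≤ ‖u(T, τy + z)‖` for all `y` (brick B1 with `g = a`), then
`‖u^{(j+1)}(t_{j+1}, x)‖ ≤ ‖u^{(j)}(t_{j+1}, x)‖` for all `j, x` (the `hdrop` hypothesis of
`isWeakNSISolution_of_piecewise`). [cite: Ozanski2017NSISingular, §2 (2.2), (2.5)] -/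
theorem norm_pieceG_succ_le {T σ τ a : ℝ} (hσ : σ ≠ 0) (hτ₀ : τ ≠ 0) (hτ₁ : τ ≠ 1) (ha : 0 ≤ a)
    (z : E) {u : ℝ → E → E} (hgain : ∀ y : E, a * ‖u 0 y‖ ≤ ‖u T (τ • y + z)‖) (j : ℕ) (x : E) :
    ‖pieceG T σ τ a z u (j + 1) (switchTime T σ (j + 1)) x‖ ≤
      ‖pieceG T σ τ a z u j (switchTime T σ (j + 1)) x‖ := by
  rw [pieceG_apply_switchTime, pieceG_apply_switchTime_succ T hσ]
  have hcoef : τ * (τ⁻¹) ^ (j + 1) = (τ⁻¹) ^ j := by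
    rw [pow_succ, ← mul_assoc, mul_comm τ, mul_assoc, mul_inv_cancel₀ hτ₀, mul_one]
  -- `Γ y = x₀ + τ^{-j}(x - x₀)` for `y = x₀ + τ^{-(j+1)}(x - x₀)`
  have hyx : τ • ((1 - τ)⁻¹ • z + (τ⁻¹) ^ (j + 1) • (x - (1 - τ)⁻¹ • z)) + z =
      (1 - τ)⁻¹ • z + (τ⁻¹) ^ j • (x - (1 - τ)⁻¹ • z) := by
    rw [smul_add, smul_smul τ ((τ⁻¹) ^ (j + 1)), hcoef, add_right_comm, smul_center_add hτ₁ z]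
  rw [← hyx, norm_smul, norm_smul, Real.norm_of_nonneg (pow_nonneg ha _),
    Real.norm_of_nonneg (pow_nonneg ha _), pow_succ, mul_assoc]
  exact mul_le_mul_of_nonneg_left (hgain _) (pow_nonneg ha _)

open _root_.Classical in
/-- **The generalised switched (glued) field** `𝔲`: `𝔲(t) = u^{(j)}(t)` on `[t_j, t_{j+1})`,
`𝔲(t) = 0` for `t ≥ T₀` and for `t < 0`. [cite: Ozanski2017NSISingular, §2 (2.4)] -/
def glueG (T σ τ a : ℝ) (z : E) (u : ℝ → E → E) : ℝ → E → E := fun t x =>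
  if h : ∃ j : ℕ, t ∈ Ico (switchTime T σ j) (switchTime T σ (j + 1)) then
    pieceG T σ τ a z u h.choose t x
  else 0

open _root_.Classical in
/-- On the `j`-th piece the glued field is `u^{(j)}` (`T > 0`, `σ > 0`). [cite: Ozanski2017NSISingular, §2 (2.4)] -/
theorem glueG_eq_pieceG {T σ : ℝ} (hT : 0 < T) (hσ : 0 < σ) (τ a : ℝ) (z : E) (u : ℝ → E → E)
    {t : ℝ} {j : ℕ} (hj : t ∈ Ico (switchTime T σ j) (switchTime T σ (j + 1))) :
    glueG T σ τ a z u t = pieceG T σ τ a z u j t := by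
  funext x
  have h : ∃ j : ℕ, t ∈ Ico (switchTime T σ j) (switchTime T σ (j + 1)) := ⟨j, hj⟩
  rw [glueG, dif_pos h, eq_of_mem_Ico_switchTime hT hσ h.choose_spec hj]

open _root_.Classical in
/-- Outside `⋃ⱼ [t_j, t_{j+1})` the glued field vanishes. [cite: Ozanski2017NSISingular, §2 (2.4)] -/
theorem glueG_eq_zero_of_not_exists {T σ : ℝ} (τ a : ℝ) (z : E) (u : ℝ → E → E) {t : ℝ}
    (h : ¬ ∃ j : ℕ, t ∈ Ico (switchTime T σ j) (switchTime T σ (j + 1))) :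
    glueG T σ τ a z u t = 0 := by
  funext x
  rw [glueG, dif_neg h]
  rfl

/-- For `t ≥ T₀` the glued field vanishes (`T > 0`, `0 < σ < 1`). [cite: Ozanski2017NSISingular, §2 (2.4)] -/
theorem glueG_eq_zero_of_le {T σ : ℝ} (hT : 0 < T) (hσ₀ : 0 < σ) (hσ₁ : σ < 1) (τ a : ℝ) (z : E)
    (u : ℝ → E → E) {t : ℝ} (ht : blowupTime T σ ≤ t) : glueG T σ τ a z u t = 0 := by
  refine glueG_eq_zero_of_not_exists τ a z u fun ⟨j, hj⟩ => ?_
  exact (not_lt.2 ht) (hj.2.trans (switchTime_lt_blowupTime hT hσ₀ hσ₁ (j + 1)))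

/-- For `t < 0` the glued field vanishes (`T > 0`, `σ > 0`). [cite: Ozanski2017NSISingular, §2 (2.4)] -/
theorem glueG_eq_zero_of_neg {T σ : ℝ} (hT : 0 < T) (hσ : 0 < σ) (τ a : ℝ) (z : E)
    (u : ℝ → E → E) {t : ℝ} (ht : t < 0) : glueG T σ τ a z u t = 0 := by
  refine glueG_eq_zero_of_not_exists τ a z u fun ⟨j, hj⟩ => ?_
  exact (not_le.2 ht) ((switchTime_nonneg hT hσ j).trans hj.1)

end Field

/-! ### The pieces satisfy the Navier–Stokes inequality (covariance constraint `aσ² = τ`) -/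

/-- **Each generalised piece of an NSI block satisfies the pointwise Navier–Stokes inequality
during its life span, at every viscosity `ν ∈ [0, ν₀]`**, provided the NSI covariance constraint
`a σ² = τ` (amplitude × time factor⁻¹ … : `σ^{-2j} = aʲ τ^{-j}`) and `aτ ≥ 1` (the effective block
viscosity `ν (aτ)^{-j}` stays in `[0, ν₀]`) hold: `nsi_superPiece` with amplitude `aʲ` and space
factor `τ^{-j}`. [cite: Ozanski2017NSISingular, §2 (2.4)] -/
theorem nsi_pieceG
    {T ν₀ τ : ℝ} {z : EuclideanSpace ℝ (Fin 3)} {G : Set (EuclideanSpace ℝ (Fin 3))}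
    {u : ℝ → EuclideanSpace ℝ (Fin 3) → EuclideanSpace ℝ (Fin 3)}
    (h : IsNSIBlock T ν₀ τ z G u) {σ a : ℝ} (ha : 0 < a) (hcov : a * σ ^ 2 = τ) (haτ : 1 ≤ a * τ)
    {ν : ℝ} (hν : ν ∈ Icc 0 ν₀) (j : ℕ) {s : ℝ}
    (hs : (σ⁻¹) ^ (2 * j) * (s - switchTime T σ j) ∈ Icc 0 T) (x : EuclideanSpace ℝ (Fin 3)) :
    timeDeriv (fun r y => ‖pieceG T σ τ a z u j r y‖ ^ 2) s x ≤
      -⟪pieceG T σ τ a z u j s x, gradient (fun y => ‖pieceG T σ τ a z u j s y‖ ^ 2 +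
          2 * normalisedPressure (pieceG T σ τ a z u j s) y) x⟫ +
        2 * ν * ⟪pieceG T σ τ a z u j s x, Δ (pieceG T σ τ a z u j s) x⟫ := by
  have hτ : 0 < τ := h.τ_pos
  -- the covariance constraint at generation `j`: `σ^{-2j} = aʲ · τ^{-j}`
  have hθ : (σ⁻¹) ^ (2 * j) = a ^ j * (τ⁻¹) ^ j := by
    have hσ2 : σ ^ 2 = τ / a := by rw [← hcov]; field_simp
    rw [inv_pow, pow_mul, hσ2, ← mul_pow, ← inv_pow]
    congr 1
    field_simp
  -- `b = τ^{-j} ≤ aʲ` from `aτ ≥ 1`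
  have hba : (τ⁻¹) ^ j ≤ a ^ j := by
    rw [inv_pow]
    refine (inv_le_iff_one_le_mul₀ (pow_pos hτ _)).2 ?_
    rw [← mul_pow]
    exact one_le_pow₀ (by simpa only [mul_comm] using haτ)
  have hs' : -((σ⁻¹) ^ (2 * j) * switchTime T σ j) + a ^ j * (τ⁻¹) ^ j * s ∈ Icc 0 T := by
    rw [← hθ]
    convert hs using 1
    ring
  have key := nsi_superPiece h (pow_pos ha j) (pow_pos (inv_pos.2 hτ) j) hba hν
    (-((σ⁻¹) ^ (2 * j) * switchTime T σ j)) ((1 - (τ⁻¹) ^ j) • (1 - τ)⁻¹ • z) hs' x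
  simpa only [pieceG, hθ] using key

/-! ### The super-similar cascade of a super-gain block -/

/-- **Parameters of the super-similar cascade of a super-gain block**: for `0 < τ < 1` and a gain
`g > τ⁻¹` put `a = g`, `σ = √(τ/g)`; then `0 < σ < 1`, `aσ² = τ` (NSI covariance), `aσ = √(gτ) > 1`
(the amplitude beats the parabolic clock) and `aτ ≥ 1`. [cite: Ozanski2017NSISingular, §2 (2.4)] -/
theorem superCascade_params {τ g : ℝ} (hτ₀ : 0 < τ) (hτ₁ : τ < 1) (hg : τ⁻¹ < g) :
    0 < Real.sqrt (τ / g) ∧ Real.sqrt (τ / g) < 1 ∧ g * Real.sqrt (τ / g) ^ 2 = τ ∧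
      1 < g * Real.sqrt (τ / g) ∧ 1 ≤ g * τ := by
  have hτinv : 0 < τ⁻¹ := inv_pos.2 hτ₀
  have hg0 : 0 < g := hτinv.trans hg
  have hgτ : 1 < g * τ := by
    have := mul_lt_mul_of_pos_right hg hτ₀
    rwa [inv_mul_cancel₀ hτ₀.ne'] at this
  have hq : 0 < τ / g := div_pos hτ₀ hg0
  have hq1 : τ / g < 1 := by
    rw [div_lt_one hg0]
    have h1 : (1 : ℝ) < τ⁻¹ := one_lt_inv_iff₀.2 ⟨hτ₀, hτ₁⟩
    linarith
  have hsq : Real.sqrt (τ / g) ^ 2 = τ / g := Real.sq_sqrt hq.le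
  refine ⟨Real.sqrt_pos.2 hq, (Real.sqrt_lt' one_pos).2 (by rwa [one_pow]), ?_, ?_, hgτ.le⟩
  · rw [hsq, mul_div_cancel₀ _ hg0.ne']
  · have h2 : (g * Real.sqrt (τ / g)) ^ 2 = g * τ := by
      rw [mul_pow, hsq]; field_simp
    nlinarith [Real.sqrt_nonneg (τ / g), sq_nonneg (g * Real.sqrt (τ / g) - 1),
      mul_nonneg hg0.le (Real.sqrt_nonneg (τ / g))]

end Literature.Barriers.NavierStokesRegularity.NSISuperCascade

end Part3

/-!
## Part 4 — port of `Summits/NavierStokesRegularity/NavierStokesRegularity/Theorems/TypeIliouvilleNoTypeII/Negative/NSISuperCascadePieces.lean` (40 declarations kept)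

# The super-similar switching cascade, I: the pieces

Negative-lane support for `Summit.NavierStokesRegularity.NavierStokesRegularity.Theses.TypeILiouville.TypeIliouvilleNoTypeII`
: first part of brick **B2** (the spine) of the kernel
discharge of the model-class barrier `Literature.Barriers.NavierStokesRegularity.NSITypeIIBlowup`
— the weak-solution packaging of the generalised switched field `glueG T σ τ a z u` of
`NSISuperCascadeNotTypeI` (amplitude `a`, parabolic clock `σ`, spatial ratio `τ`), i.e. the
parametrised copy of the tree's `SchefferSwitchedPieces` (which is the case `σ = τ`, `a = τ⁻¹`).

* `IsSuperBlock T ν₀ τ σ a z G u` — the hypotheses of the super-similar cascade bundled: an NSI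
  block `IsNSIBlock T ν₀ τ z G u`, a clock `0 < σ` with the NSI covariance constraint `a σ² = τ`,
  a super-gain `τ⁻¹ < a` realised by the block (`a‖u(0,y)‖ ≤ ‖u(T, τy + z)‖`, brick B1
  `exists_superGain_nsiBlock`), and the ENERGY CAP `a² τ³ ≤ 1` (slice energies scale by
  `(a²τ³)ʲ`; the cap keeps `sup_t ∫|𝔲(t)|² < ∞`);
* scalar bookkeeping: `1 < a`, `σ < 1`, `σ^{-2j} = aʲτ^{-j}`, and the four geometric ratios
  `aⁿ⁻¹τ⁴ (n ≤ 3)`, `τ³`, `aτ²`, `a²τ⁴`, all `< 1`;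
* per piece `pieceG … j` on `[t_j, t_{j+1}]` (`t_j = switchTime T σ j`): joint smoothness, `C^∞`
  slices supported in `G`, incompressibility, pressure covariance
  `p̃[u^{(j)}(t)] = a^{2j} p̃[u(s)] ∘ Γ^{-j}`, the pointwise NSI (`nsi_pieceG`), the drop condition
  (`norm_pieceG_succ_le`), the local energy inequality with boundary terms on `[t_j, t_{j+1}]`,
  `L^{3/2}` pressure slices and the weak pressure Poisson equation.

Continued in `NSISuperCascadeStrips` (strip integrals, space–time integrability) and
`NSISuperCascadeWeak` (measurability, energy, `IsWeakNSISolution`).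
[cite: Ozanski2017NSISingular, §2 (2.2)–(2.5) and pp. 6–7]; the two-parameter bookkeeping is [folklore].

(Verbatim declaration-level port — the declarations listed in the Part header count — of the Summits-side module of the
NavierStokesRegularity tree (negative lane of `TypeIliouvilleNoTypeII`); route / lane bookkeeping in the text above is historical.)
-/

section Part4

open _root_.MeasureTheory _root_.Set _root_.Function _root_.Filter _root_.Topology _root_.TopologicalSpace _root_.Metric _root_.Module
open scoped _root_.ENNReal _root_.InnerProductSpace RealInnerProductSpace _root_.ContDiff Laplacian

namespace Literature.Barriers.NavierStokesRegularity.NSISuperCascade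

open Literature.Analysis.FluidPDE Literature.Barriers.NavierStokesRegularity
open Literature.Barriers.NavierStokesRegularity.Scheffer

/-! ### The hypotheses of the super-similar cascade -/

/-- **A super-similar NSI cascade datum**: an NSI block `(T, ν₀, τ, z, G, u)` together with an
amplitude `a > τ⁻¹` realised as a gain of the block (`a‖u(0,y)‖ ≤ ‖u(T, τy+z)‖`), a parabolic
clock `σ > 0` tied to it by the NSI covariance constraint `a σ² = τ`, and the energy cap
`a²τ³ ≤ 1`. [cite: Ozanski2017NSISingular, §2 (2.4)] -/
structure IsSuperBlock (T ν₀ τ σ a : ℝ) (z : (EuclideanSpace ℝ (Fin 3))) (G : Set (EuclideanSpace ℝ (Fin 3))) (u : ℝ → (EuclideanSpace ℝ (Fin 3)) → (EuclideanSpace ℝ (Fin 3))) : Prop where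
  block : IsNSIBlock T ν₀ τ z G u
  σ_pos : 0 < σ
  cov : a * σ ^ 2 = τ
  inv_lt : τ⁻¹ < a
  cap : a ^ 2 * τ ^ 3 ≤ 1
  gain : ∀ y : (EuclideanSpace ℝ (Fin 3)), a * ‖u 0 y‖ ≤ ‖u T (τ • y + z)‖

/-- Slice formula for the generalised piece as a map `x ↦ aʲ u(s, x₁ + τ^{-j}x)`. [cite: Ozanski2017NSISingular, §2 (2.4)] -/
theorem pieceG_slice_eq_smul_comp_affine (T σ τ a : ℝ) (z : (EuclideanSpace ℝ (Fin 3))) (u : ℝ → (EuclideanSpace ℝ (Fin 3)) → (EuclideanSpace ℝ (Fin 3))) (j : ℕ) (t : ℝ) :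
    pieceG T σ τ a z u j t = fun x => a ^ j •
      u ((σ⁻¹) ^ (2 * j) * (t - switchTime T σ j))
        ((1 - (τ⁻¹) ^ j) • (1 - τ)⁻¹ • z + (τ⁻¹) ^ j • x) := by
  funext x
  rw [pieceG_apply]
  congr 2
  rw [smul_sub, sub_smul, one_smul, smul_comm ((τ⁻¹) ^ j) ((1 - τ)⁻¹) z]
  abel

namespace IsSuperBlock

variable {T ν₀ τ σ a : ℝ} {z : (EuclideanSpace ℝ (Fin 3))} {G : Set (EuclideanSpace ℝ (Fin 3))} {u : ℝ → (EuclideanSpace ℝ (Fin 3)) → (EuclideanSpace ℝ (Fin 3))}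

/-! ### Scalar bookkeeping -/

/-- `T > 0`. [cite: Ozanski2017NSISingular, §2 (2.4)] -/
theorem T_pos (h : IsSuperBlock T ν₀ τ σ a z G u) : 0 < T := h.block.T_pos

/-- `τ > 0`. [cite: Ozanski2017NSISingular, §2 (2.4)] -/
theorem τ_pos (h : IsSuperBlock T ν₀ τ σ a z G u) : 0 < τ := h.block.τ_pos

/-- `τ < 1`. [cite: Ozanski2017NSISingular, §2 (2.4)] -/
theorem τ_lt_one (h : IsSuperBlock T ν₀ τ σ a z G u) : τ < 1 := h.block.τ_lt_one

/-- `G` is compact. [cite: Ozanski2017NSISingular, §2 (2.4)] -/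
theorem isCompact (h : IsSuperBlock T ν₀ τ σ a z G u) : IsCompact G := h.block.isCompact

/-- `1 < τ⁻¹`. [cite: Ozanski2017NSISingular, §2 (2.4)] -/
theorem one_lt_inv_tau (h : IsSuperBlock T ν₀ τ σ a z G u) : 1 < τ⁻¹ :=
  (one_lt_inv₀ h.τ_pos).2 h.τ_lt_one

/-- `1 < a`. [cite: Ozanski2017NSISingular, §2 (2.4)] -/
theorem one_lt_gain (h : IsSuperBlock T ν₀ τ σ a z G u) : 1 < a := h.one_lt_inv_tau.trans h.inv_lt

/-- `0 < a`. [cite: Ozanski2017NSISingular, §2 (2.4)] -/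
theorem gain_pos (h : IsSuperBlock T ν₀ τ σ a z G u) : 0 < a := one_pos.trans h.one_lt_gain

/-- `0 < aⁿ`. [cite: Ozanski2017NSISingular, §2 (2.4)] -/
theorem gain_pow_pos (h : IsSuperBlock T ν₀ τ σ a z G u) (n : ℕ) : 0 < a ^ n := pow_pos h.gain_pos n

/-- `0 < τ^{-n}`. [cite: Ozanski2017NSISingular, §2 (2.4)] -/
theorem inv_tau_pow_pos (h : IsSuperBlock T ν₀ τ σ a z G u) (n : ℕ) : 0 < (τ⁻¹) ^ n :=
  pow_pos (inv_pos.2 h.τ_pos) n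

/-- `0 < σ^{-n}`. [cite: Ozanski2017NSISingular, §2 (2.4)] -/
theorem inv_σ_pow_pos (h : IsSuperBlock T ν₀ τ σ a z G u) (n : ℕ) : 0 < (σ⁻¹) ^ n :=
  pow_pos (inv_pos.2 h.σ_pos) n

/-- `1 ≤ aτ`. [cite: Ozanski2017NSISingular, §2 (2.4)] -/
theorem one_le_gain_mul (h : IsSuperBlock T ν₀ τ σ a z G u) : 1 ≤ a * τ := by
  have := mul_lt_mul_of_pos_right h.inv_lt h.τ_pos
  rw [inv_mul_cancel₀ h.τ_pos.ne'] at this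
  exact this.le

/-- `σ² = τ/a`. [cite: Ozanski2017NSISingular, §2 (2.4)] -/
theorem σ_sq (h : IsSuperBlock T ν₀ τ σ a z G u) : σ ^ 2 = τ / a := by
  rw [eq_div_iff h.gain_pos.ne', mul_comm]
  exact h.cov

/-- `σ² < 1`. [cite: Ozanski2017NSISingular, §2 (2.4)] -/
theorem σ_sq_lt_one (h : IsSuperBlock T ν₀ τ σ a z G u) : σ ^ 2 < 1 := by
  rw [h.σ_sq, div_lt_one h.gain_pos]
  exact h.τ_lt_one.trans h.one_lt_gain

/-- `σ < 1`. [cite: Ozanski2017NSISingular, §2 (2.4)] -/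
theorem σ_lt_one (h : IsSuperBlock T ν₀ τ σ a z G u) : σ < 1 := by
  by_contra h1
  have h2 : 1 ≤ σ := not_lt.1 h1
  have := h.σ_sq_lt_one
  nlinarith

/-- **The covariance constraint at generation `j`**: `σ^{-2j} = aʲ τ^{-j}`. [cite: Ozanski2017NSISingular, §2 (2.4)] -/
theorem inv_σ_pow_two_mul (h : IsSuperBlock T ν₀ τ σ a z G u) (j : ℕ) :
    (σ⁻¹) ^ (2 * j) = a ^ j * (τ⁻¹) ^ j := by
  have h1 : (σ⁻¹) ^ 2 = a * τ⁻¹ := by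
    rw [inv_pow, h.σ_sq, inv_div, div_eq_mul_inv]
  rw [pow_mul, h1, mul_pow]

/-- `a²τ⁴ < 1`. [cite: Ozanski2017NSISingular, §2 (2.4)] -/
theorem gain_sq_mul_pow_four_lt_one (h : IsSuperBlock T ν₀ τ σ a z G u) : a ^ 2 * τ ^ 4 < 1 := by
  have e : a ^ 2 * τ ^ 4 = a ^ 2 * τ ^ 3 * τ := by ring
  rw [e]
  calc a ^ 2 * τ ^ 3 * τ ≤ 1 * τ := mul_le_mul_of_nonneg_right h.cap h.τ_pos.le
    _ < 1 := by rw [one_mul]; exact h.τ_lt_one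

/-- `aτ² < 1`. [cite: Ozanski2017NSISingular, §2 (2.4)] -/
theorem gain_mul_sq_lt_one (h : IsSuperBlock T ν₀ τ σ a z G u) : a * τ ^ 2 < 1 := by
  have h1 : (a * τ ^ 2) ^ 2 < 1 := by
    have e : (a * τ ^ 2) ^ 2 = a ^ 2 * τ ^ 4 := by ring
    rw [e]
    exact h.gain_sq_mul_pow_four_lt_one
  have h0 : 0 ≤ a * τ ^ 2 := mul_nonneg h.gain_pos.le (sq_nonneg τ)
  by_contra hc
  have h2 : 1 ≤ a * τ ^ 2 := not_lt.1 hc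
  nlinarith

/-- `τ³ < 1`. [cite: Ozanski2017NSISingular, §2 (2.4)] -/
theorem pow_three_lt_one (h : IsSuperBlock T ν₀ τ σ a z G u) : τ ^ 3 < 1 :=
  pow_lt_one₀ h.τ_pos.le h.τ_lt_one (by norm_num)

/-- `0 ≤ aⁿ a⁻¹ τ⁴`. [cite: Ozanski2017NSISingular, §2 (2.4)] -/
theorem pow_ratio_nonneg (h : IsSuperBlock T ν₀ τ σ a z G u) (n : ℕ) : 0 ≤ a ^ n * a⁻¹ * τ ^ 4 :=
  mul_nonneg (mul_nonneg (h.gain_pow_pos n).le (inv_pos.2 h.gain_pos).le) (pow_nonneg h.τ_pos.le 4)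

/-- `aⁿ a⁻¹ τ⁴ < 1` for `n ≤ 3`. [cite: Ozanski2017NSISingular, §2 (2.4)] -/
theorem pow_ratio_lt_one (h : IsSuperBlock T ν₀ τ σ a z G u) {n : ℕ} (hn : n ≤ 3) :
    a ^ n * a⁻¹ * τ ^ 4 < 1 := by
  have h1 : a ^ n ≤ a ^ 3 := pow_le_pow_right₀ h.one_lt_gain.le hn
  have h0 : 0 ≤ a⁻¹ * τ ^ 4 := mul_nonneg (inv_pos.2 h.gain_pos).le (pow_nonneg h.τ_pos.le 4)
  have h3 : a ^ 3 * a⁻¹ = a ^ 2 := by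
    calc a ^ 3 * a⁻¹ = a ^ 2 * (a * a⁻¹) := by ring
      _ = a ^ 2 := by rw [mul_inv_cancel₀ h.gain_pos.ne', mul_one]
  calc a ^ n * a⁻¹ * τ ^ 4 = a ^ n * (a⁻¹ * τ ^ 4) := by ring
    _ ≤ a ^ 3 * (a⁻¹ * τ ^ 4) := mul_le_mul_of_nonneg_right h1 h0
    _ = a ^ 3 * a⁻¹ * τ ^ 4 := by ring
    _ = a ^ 2 * τ ^ 4 := by rw [h3]
    _ < 1 := h.gain_sq_mul_pow_four_lt_one

/-- Scalar identity behind the strip integral of `‖𝔲‖ⁿ`: `(aʲ)ⁿ (a⁻¹τ⁴)ʲ = (aⁿ a⁻¹ τ⁴)ʲ`. [cite: Ozanski2017NSISingular, §2 (2.4)] -/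
theorem scalar_pow (a τ : ℝ) (j n : ℕ) :
    (a ^ j) ^ n * (a⁻¹ * τ ^ 4) ^ j = (a ^ n * a⁻¹ * τ ^ 4) ^ j := by
  rw [← pow_mul, mul_comm j n, pow_mul, ← mul_pow, ← mul_assoc]

/-- Scalar identity behind the strip integral of `‖D𝔲‖`: `aʲ τ^{-j} (a⁻¹τ⁴)ʲ = (τ³)ʲ`. [cite: Ozanski2017NSISingular, §2 (2.4)] -/
theorem scalar_fderiv (h : IsSuperBlock T ν₀ τ σ a z G u) (j : ℕ) :
    a ^ j * (τ⁻¹) ^ j * (a⁻¹ * τ ^ 4) ^ j = (τ ^ 3) ^ j := by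
  have hb : a * τ⁻¹ * (a⁻¹ * τ ^ 4) = τ ^ 3 := by
    calc a * τ⁻¹ * (a⁻¹ * τ ^ 4) = (a * a⁻¹) * (τ⁻¹ * τ) * τ ^ 3 := by ring
      _ = τ ^ 3 := by rw [mul_inv_cancel₀ h.gain_pos.ne', inv_mul_cancel₀ h.τ_pos.ne', one_mul, one_mul]
  rw [← mul_pow, ← mul_pow, hb]

/-- Scalar identity behind the strip integral of `|D𝔲|²`: `(aʲ τ^{-j})² (a⁻¹τ⁴)ʲ = (aτ²)ʲ`. [cite: Ozanski2017NSISingular, §2 (2.4)] -/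
theorem scalar_frobenius (h : IsSuperBlock T ν₀ τ σ a z G u) (j : ℕ) :
    (a ^ j * (τ⁻¹) ^ j) ^ 2 * (a⁻¹ * τ ^ 4) ^ j = (a * τ ^ 2) ^ j := by
  have hb : (a * τ⁻¹) ^ 2 * (a⁻¹ * τ ^ 4) = a * τ ^ 2 := by
    calc (a * τ⁻¹) ^ 2 * (a⁻¹ * τ ^ 4) = (a * a⁻¹) * (τ⁻¹ * τ) ^ 2 * (a * τ ^ 2) := by ring
      _ = a * τ ^ 2 := by
        rw [mul_inv_cancel₀ h.gain_pos.ne', inv_mul_cancel₀ h.τ_pos.ne', one_pow, one_mul, one_mul]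
  rw [← mul_pow, ← pow_mul, mul_comm j 2, pow_mul, ← mul_pow, hb]

/-- Scalar identity behind the strip integral of `|p̃[𝔲]|‖𝔲‖`: `(aʲ)³ (a⁻¹τ⁴)ʲ = (a²τ⁴)ʲ`. [cite: Ozanski2017NSISingular, §2 (2.4)] -/
theorem scalar_pressure (h : IsSuperBlock T ν₀ τ σ a z G u) (j : ℕ) :
    (a ^ j) ^ 3 * (a⁻¹ * τ ^ 4) ^ j = (a ^ 2 * τ ^ 4) ^ j := by
  have hb : a ^ 3 * (a⁻¹ * τ ^ 4) = a ^ 2 * τ ^ 4 := by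
    calc a ^ 3 * (a⁻¹ * τ ^ 4) = a ^ 2 * (a * a⁻¹) * τ ^ 4 := by ring
      _ = a ^ 2 * τ ^ 4 := by rw [mul_inv_cancel₀ h.gain_pos.ne', mul_one]
  rw [← pow_mul, mul_comm j 3, pow_mul, ← mul_pow, hb]

/-! ### Smoothness, support and incompressibility of the pieces -/

/-- The local time `σ^{-2j}(t - t_j)` of the `j`-th piece (written as the affine expression of the
pull-back) lies in `[0, T]` for `t ∈ [t_j, t_{j+1}]`. [cite: Ozanski2017NSISingular, §2 (2.4)] -/
theorem localTime_mem (h : IsSuperBlock T ν₀ τ σ a z G u) {j : ℕ} {t : ℝ}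
    (ht : t ∈ Icc (switchTime T σ j) (switchTime T σ (j + 1))) :
    -((σ⁻¹) ^ (2 * j) * switchTime T σ j) + (σ⁻¹) ^ (2 * j) * t ∈ Icc 0 T := by
  have := localTime_mem_Icc (T := T) h.σ_pos ht
  convert this using 1
  ring

/-- **The `j`-th piece is jointly smooth on an open slab around `[t_j, t_{j+1}]`.**
[cite: Ozanski2017NSISingular, §2 (2.4)] -/
theorem isSmoothSpaceTimeOn_pieceG (h : IsSuperBlock T ν₀ τ σ a z G u) (j : ℕ) :
    ∃ η : ℝ, 0 < η ∧ IsSmoothSpaceTimeOn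
      ((fun r => -((σ⁻¹) ^ (2 * j) * switchTime T σ j) + (σ⁻¹) ^ (2 * j) * r) ⁻¹' Ioo (-η) (T + η))
      (pieceG T σ τ a z u j) := by
  obtain ⟨η, hη, hs⟩ := h.block.smooth
  exact ⟨η, hη, hs.smul_stPull _ _ _ _ _⟩

/-- The slices `u^{(j)}(t)`, `t ∈ [t_j, t_{j+1}]`, are `C^∞`. [cite: Ozanski2017NSISingular, §2 (2.4)] -/
theorem contDiff_pieceG_slice (h : IsSuperBlock T ν₀ τ σ a z G u) {j : ℕ} {t : ℝ}
    (ht : t ∈ Icc (switchTime T σ j) (switchTime T σ (j + 1))) :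
    ContDiff ℝ ∞ (pieceG T σ τ a z u j t) := by
  have hσ' := h.block.contDiff_slice (h.localTime_mem ht)
  exact (contDiff_stPull_slice (β := (σ⁻¹) ^ (2 * j)) (γ := (τ⁻¹) ^ j)
    (x₀ := (1 - (τ⁻¹) ^ j) • (1 - τ)⁻¹ • z) hσ').const_smul (a ^ j)

/-- **The pieces vanish off `G`.** [cite: Ozanski2017NSISingular, §2 (2.5)] -/
theorem pieceG_apply_eq_zero (h : IsSuperBlock T ν₀ τ σ a z G u) {j : ℕ} {t : ℝ}
    (ht : t ∈ Icc (switchTime T σ j) (switchTime T σ (j + 1))) {x : (EuclideanSpace ℝ (Fin 3))} (hx : x ∉ G) :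
    pieceG T σ τ a z u j t x = 0 := by
  rw [pieceG_apply]
  have hy : (1 - τ)⁻¹ • z + (τ⁻¹) ^ j • (x - (1 - τ)⁻¹ • z) ∉ G := fun hy =>
    hx (h.block.mem_of_inv_similarity_mem hy)
  have hs : (σ⁻¹) ^ (2 * j) * (t - switchTime T σ j) ∈ Icc 0 T := localTime_mem_Icc h.σ_pos ht
  rw [← h.block.tsupport_eq _ hs] at hy
  rw [image_eq_zero_of_notMem_tsupport hy, smul_zero]

/-- The slices of the pieces have topological support in `G`. [cite: Ozanski2017NSISingular, §2 (2.4)] -/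
theorem tsupport_pieceG_slice_subset (h : IsSuperBlock T ν₀ τ σ a z G u) {j : ℕ} {t : ℝ}
    (ht : t ∈ Icc (switchTime T σ j) (switchTime T σ (j + 1))) :
    tsupport (pieceG T σ τ a z u j t) ⊆ G :=
  closure_minimal (fun x hx => by by_contra h'; exact hx (h.pieceG_apply_eq_zero ht h'))
    h.isCompact.isClosed

/-- The slices of the pieces have compact support. [cite: Ozanski2017NSISingular, §2 (2.4)] -/
theorem hasCompactSupport_pieceG_slice (h : IsSuperBlock T ν₀ τ σ a z G u) {j : ℕ} {t : ℝ}
    (ht : t ∈ Icc (switchTime T σ j) (switchTime T σ (j + 1))) :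
    HasCompactSupport (pieceG T σ τ a z u j t) :=
  h.isCompact.of_isClosed_subset (isClosed_tsupport _) (h.tsupport_pieceG_slice_subset ht)

/-- **The pieces are divergence free** (chain rule). [cite: Ozanski2017NSISingular, §2 p. 6] -/
theorem isDivFree_pieceG (h : IsSuperBlock T ν₀ τ σ a z G u) {j : ℕ} {t : ℝ}
    (ht : t ∈ Icc (switchTime T σ j) (switchTime T σ (j + 1))) :
    VectorCalculus.IsDivFree (pieceG T σ τ a z u j t) := by
  intro x
  have hs := h.localTime_mem ht
  have hu1 : ContDiff ℝ 1 (u (-((σ⁻¹) ^ (2 * j) * switchTime T σ j) + (σ⁻¹) ^ (2 * j) * t)) :=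
    (h.block.contDiff_slice hs).of_le (by norm_cast)
  have hd : DifferentiableAt ℝ (stPull ((σ⁻¹) ^ (2 * j)) ((τ⁻¹) ^ j)
      (-((σ⁻¹) ^ (2 * j) * switchTime T σ j)) ((1 - (τ⁻¹) ^ j) • (1 - τ)⁻¹ • z) u t) x :=
    differentiable_stPull_slice (hu1.differentiable (by simp)) x
  rw [pieceG, show (a ^ j • stPull ((σ⁻¹) ^ (2 * j)) ((τ⁻¹) ^ j)
      (-((σ⁻¹) ^ (2 * j) * switchTime T σ j)) ((1 - (τ⁻¹) ^ j) • (1 - τ)⁻¹ • z) u) t =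
      fun y => a ^ j • stPull ((σ⁻¹) ^ (2 * j)) ((τ⁻¹) ^ j)
        (-((σ⁻¹) ^ (2 * j) * switchTime T σ j)) ((1 - (τ⁻¹) ^ j) • (1 - τ)⁻¹ • z) u t y from rfl,
    divergence_const_smul_apply hd, divergence_stPull, h.block.divFree _ hs, mul_zero, mul_zero]

/-! ### Pressure, Navier–Stokes inequality and local energy inequality of the pieces -/

/-- **The pressure function of a piece is the rescaled pressure function**:
`p̃[u^{(j)}(t)](x) = a^{2j} p̃[u(s)](Γ^{-j}x)`, `s` the local time. [cite: Ozanski2017NSISingular, §2 (2.4)] -/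
theorem normalisedPressure_pieceG (h : IsSuperBlock T ν₀ τ σ a z G u) (j : ℕ) (t : ℝ) (x : (EuclideanSpace ℝ (Fin 3))) :
    normalisedPressure (pieceG T σ τ a z u j t) x = (a ^ j) ^ 2 *
      normalisedPressure (u (-((σ⁻¹) ^ (2 * j) * switchTime T σ j) + (σ⁻¹) ^ (2 * j) * t))
        ((1 - (τ⁻¹) ^ j) • (1 - τ)⁻¹ • z + (τ⁻¹) ^ j • x) := by
  have e : pieceG T σ τ a z u j t = fun y => a ^ j •
      u (-((σ⁻¹) ^ (2 * j) * switchTime T σ j) + (σ⁻¹) ^ (2 * j) * t)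
        ((1 - (τ⁻¹) ^ j) • (1 - τ)⁻¹ • z + (τ⁻¹) ^ j • y) := by
    rw [pieceG_slice_eq_smul_comp_affine]
    funext y
    congr 2
    ring
  rw [e]
  exact normalisedPressure_smul_comp_affine _ _ _ (h.inv_tau_pow_pos j) x

/-- **The pieces satisfy the pointwise Navier–Stokes inequality on their life spans** at every
`ν ∈ [0, ν₀]` (`nsi_pieceG` under `aσ² = τ`, `aτ ≥ 1`). [cite: Ozanski2017NSISingular, §2 (2.4)] -/
theorem nsi_pieceG_of_mem (h : IsSuperBlock T ν₀ τ σ a z G u) {ν : ℝ} (hν : ν ∈ Icc 0 ν₀) {j : ℕ}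
    {t : ℝ} (ht : t ∈ Icc (switchTime T σ j) (switchTime T σ (j + 1))) (x : (EuclideanSpace ℝ (Fin 3))) :
    timeDeriv (fun r y => ‖pieceG T σ τ a z u j r y‖ ^ 2) t x ≤
      -⟪pieceG T σ τ a z u j t x, gradient (fun y => ‖pieceG T σ τ a z u j t y‖ ^ 2 +
          2 * normalisedPressure (pieceG T σ τ a z u j t) y) x⟫ +
        2 * ν * ⟪pieceG T σ τ a z u j t x, Δ (pieceG T σ τ a z u j t) x⟫ :=
  nsi_pieceG h.block h.gain_pos h.cov h.one_le_gain_mul hν j (localTime_mem_Icc h.σ_pos ht) x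

/-- **The drop condition at the switching times** (from the super-gain). [cite: Ozanski2017NSISingular, §2 (2.5)] -/
theorem norm_pieceG_succ_le' (h : IsSuperBlock T ν₀ τ σ a z G u) (j : ℕ) (x : (EuclideanSpace ℝ (Fin 3))) :
    ‖pieceG T σ τ a z u (j + 1) (switchTime T σ (j + 1)) x‖ ≤
      ‖pieceG T σ τ a z u j (switchTime T σ (j + 1)) x‖ :=
  norm_pieceG_succ_le h.σ_pos.ne' h.τ_pos.ne' h.τ_lt_one.ne h.gain_pos.le z h.gain j x

/-- The pressure of the `j`-th piece is jointly continuous on the closed strip. [cite: Ozanski2017NSISingular, §2 (2.4)] -/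
theorem continuousOn_normalisedPressure_pieceG (h : IsSuperBlock T ν₀ τ σ a z G u) (j : ℕ) :
    ContinuousOn (fun q : ℝ × (EuclideanSpace ℝ (Fin 3)) => normalisedPressure (pieceG T σ τ a z u j q.1) q.2)
      (Icc (switchTime T σ j) (switchTime T σ (j + 1)) ×ˢ univ) := by
  obtain ⟨η, hη, hsm⟩ := h.isSmoothSpaceTimeOn_pieceG j
  have hlt : switchTime T σ j < switchTime T σ (j + 1) :=
    strictMono_switchTime h.T_pos h.σ_pos (Nat.lt_succ_self j)
  exact continuousOn_normalisedPressure_slice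
    (hsm.mono (Icc_switchTime_subset_preimage h.σ_pos hη j)) (uniqueDiffOn_Icc hlt) h.isCompact
    fun t ht x hx => h.pieceG_apply_eq_zero ht hx

/-- **The local energy inequality with boundary terms for the `j`-th piece on `[t_j, t_{j+1}]`**,
for every `ν ∈ [0, ν₀]` and every nonnegative space–time test function.
[cite: Ozanski2017NSISingular, §2 p. 7] -/
theorem localEnergyIneq_pieceG (h : IsSuperBlock T ν₀ τ σ a z G u) {ν : ℝ} (hν : ν ∈ Icc 0 ν₀) (j : ℕ)
    {φ : ℝ → (EuclideanSpace ℝ (Fin 3)) → ℝ} (hφ : IsSpaceTimeTestOn (⊤ : Opens (ℝ × (EuclideanSpace ℝ (Fin 3)))) φ) (hφ0 : ∀ s x, 0 ≤ φ s x) :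
    (∫ x, ‖pieceG T σ τ a z u j (switchTime T σ (j + 1)) x‖ ^ 2 * φ (switchTime T σ (j + 1)) x) -
        (∫ x, ‖pieceG T σ τ a z u j (switchTime T σ j) x‖ ^ 2 * φ (switchTime T σ j) x) +
        2 * ν * ∫ s in Ioo (switchTime T σ j) (switchTime T σ (j + 1)), ∫ x,
          frobeniusNormSq (fderiv ℝ (pieceG T σ τ a z u j s) x) * φ s x ≤
      ∫ s in Ioo (switchTime T σ j) (switchTime T σ (j + 1)), ∫ x,
        (‖pieceG T σ τ a z u j s x‖ ^ 2 * (timeDeriv φ s x + ν * Δ (φ s) x) +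
          (‖pieceG T σ τ a z u j s x‖ ^ 2 + 2 * normalisedPressure (pieceG T σ τ a z u j s) x) *
            ⟪pieceG T σ τ a z u j s x, gradient (φ s) x⟫) := by
  obtain ⟨η, hη, hsm⟩ := h.isSmoothSpaceTimeOn_pieceG j
  have hlt : switchTime T σ j < switchTime T σ (j + 1) :=
    strictMono_switchTime h.T_pos h.σ_pos (Nat.lt_succ_self j)
  have hopen : IsOpen ((fun r => -((σ⁻¹) ^ (2 * j) * switchTime T σ j) + (σ⁻¹) ^ (2 * j) * r) ⁻¹'
      Ioo (-η) (T + η)) := isOpen_Ioo.preimage (by fun_prop)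
  exact nsi_localEnergyIneq_Icc hlt.le hopen (Icc_switchTime_subset_preimage h.σ_pos hη j) hsm
    h.isCompact (fun s hs x hx => h.pieceG_apply_eq_zero hs hx) (fun s hs => h.isDivFree_pieceG hs)
    (fun s hs => (contDiff_normalisedPressure_of_hasCompactSupport (h.contDiff_pieceG_slice hs)
      (h.hasCompactSupport_pieceG_slice hs)).of_le one_le_two)
    (h.continuousOn_normalisedPressure_pieceG j) (fun s hs x => h.nsi_pieceG_of_mem hν hs x) hφ hφ0

/-- The pressure slices of the pieces are in `L^{3/2}((EuclideanSpace ℝ (Fin 3)))`. [cite: Ozanski2019NSI, Def. 1.1] -/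
theorem memLp_normalisedPressure_pieceG (h : IsSuperBlock T ν₀ τ σ a z G u) {j : ℕ} {t : ℝ}
    (ht : t ∈ Icc (switchTime T σ j) (switchTime T σ (j + 1))) :
    MemLp (normalisedPressure (pieceG T σ τ a z u j t)) (3 / 2 : ℝ≥0∞) volume :=
  memLp_normalisedPressure_three_halves (h.contDiff_pieceG_slice ht) (h.hasCompactSupport_pieceG_slice ht)

/-- The pressure slices of the pieces solve the pressure Poisson equation weakly.
[cite: Ozanski2019NSI, Def. 1.1 (1.1)] -/
theorem poisson_normalisedPressure_pieceG (h : IsSuperBlock T ν₀ τ σ a z G u) {j : ℕ} {t : ℝ}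
    (ht : t ∈ Icc (switchTime T σ j) (switchTime T σ (j + 1))) {ψ : (EuclideanSpace ℝ (Fin 3)) → ℝ}
    (hψ : Literature.Analysis.FunctionSpaces.IsTestFunctionOn (⊤ : Opens (EuclideanSpace ℝ (Fin 3))) ψ) :
    -∫ x, normalisedPressure (pieceG T σ τ a z u j t) x * Δ ψ x =
      ∫ x, fderiv ℝ (fderiv ℝ ψ) x (pieceG T σ τ a z u j t x) (pieceG T σ τ a z u j t x) :=
  integral_normalisedPressure_mul_laplacian (h.contDiff_pieceG_slice ht)
    (h.hasCompactSupport_pieceG_slice ht) (hψ.contDiff.of_le (by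
      change ((2 : ℕ∞) : WithTop ℕ∞) ≤ ((⊤ : ℕ∞) : WithTop ℕ∞)
      exact_mod_cast le_top))
    hψ.hasCompactSupport

end IsSuperBlock

end Literature.Barriers.NavierStokesRegularity.NSISuperCascade

end Part4

/-!
## Part 5 — port of `Summits/NavierStokesRegularity/NavierStokesRegularity/Theorems/TypeIliouvilleNoTypeII/Negative/NSISuperCascadeStrips.lean` (16 declarations kept)

# The super-similar switching cascade, II: strip integrals and space–time integrability

Negative-lane support for `Summit.NavierStokesRegularity.NavierStokesRegularity.Theses.TypeILiouville.TypeIliouvilleNoTypeII`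
: second part of brick **B2** of the discharge of
`Literature.Barriers.NavierStokesRegularity.NSITypeIIBlowup`, the parametrised copy of the tree's
`SchefferSwitchedStrips` / `SchefferSwitchedIntegrability` for the generalised switched field
`glueG T σ τ a z u` under `IsSuperBlock T ν₀ τ σ a z G u`.

* the `j`-th strip `[t_j, t_{j+1}) × EuclideanSpace ℝ (Fin 3)` is the preimage of `[0,T) × EuclideanSpace ℝ (Fin 3)` under the piece's affine
  map, with Jacobian `(a⁻¹ τ⁴)ʲ` (`jacobian_eq`);
* on the strip, `𝔲`, `D𝔲`, `p̃[𝔲]‖𝔲‖` are rescaled pull-backs of `u`, `Du`, `p̃[u]‖u‖` with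
  amplitudes `aʲ`, `aʲτ^{-j}`, `a^{3j}`;
* the strip integrals of `‖𝔲‖ₑⁿ`, `‖D𝔲‖ₑ`, `|D𝔲|²`, `|p̃[𝔲]|‖𝔲‖` are `(aⁿa⁻¹τ⁴)ʲ`, `(τ³)ʲ`,
  `(aτ²)ʲ`, `(a²τ⁴)ʲ` times the base integrals over `[0,T) × EuclideanSpace ℝ (Fin 3)`;
* summing the geometric series (ratios `< 1` by `τ⁻¹ < a`, `a²τ³ ≤ 1`, `τ < 1`):
  `∫⁻ ‖𝔲‖ₑⁿ < ∞ (1 ≤ n ≤ 3)`, `∫⁻ ‖D𝔲‖ₑ < ∞`, `∫⁻ |D𝔲|² < ∞`, `∫⁻ |p̃[𝔲]|‖𝔲‖ < ∞`.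

[cite: Ozanski2017NSISingular, §2 p. 7] [cite: Scheffer1985, proof of Lemma 2.3 (2.34)];
the two-parameter bookkeeping is [folklore].

(Verbatim declaration-level port — the declarations listed in the Part header count — of the Summits-side module of the
NavierStokesRegularity tree (negative lane of `TypeIliouvilleNoTypeII`); route / lane bookkeeping in the text above is historical.)
-/

section Part5

open _root_.MeasureTheory _root_.Set _root_.Function _root_.Filter _root_.Topology _root_.TopologicalSpace _root_.Metric _root_.Module
open scoped _root_.ENNReal _root_.InnerProductSpace RealInnerProductSpace _root_.ContDiff Laplacian

namespace Literature.Barriers.NavierStokesRegularity.NSISuperCascade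

open Literature.Analysis.FluidPDE Literature.Barriers.NavierStokesRegularity
open Literature.Barriers.NavierStokesRegularity.Scheffer

namespace IsSuperBlock

variable {T ν₀ τ σ a : ℝ} {z : EuclideanSpace ℝ (Fin 3)} {G : Set (EuclideanSpace ℝ (Fin 3))} {u : ℝ → EuclideanSpace ℝ (Fin 3) → EuclideanSpace ℝ (Fin 3)}

/-! ### The strips as preimages and the Jacobian factor -/

/-- **The `j`-th strip is the preimage of `[0, T) × EuclideanSpace ℝ (Fin 3)`** under the affine map of the `j`-th
piece. [cite: Ozanski2017NSISingular, §2 (2.4)] -/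
theorem preimage_stAffine_eq_strip (h : IsSuperBlock T ν₀ τ σ a z G u) (j : ℕ) :
    stAffine ((σ⁻¹) ^ (2 * j)) ((τ⁻¹) ^ j) (-((σ⁻¹) ^ (2 * j) * switchTime T σ j))
        ((1 - (τ⁻¹) ^ j) • (1 - τ)⁻¹ • z) ⁻¹' (Ico 0 T ×ˢ (univ : Set (EuclideanSpace ℝ (Fin 3)))) =
      Ico (switchTime T σ j) (switchTime T σ (j + 1)) ×ˢ univ := by
  have hβ : 0 < (σ⁻¹) ^ (2 * j) := h.inv_σ_pow_pos _
  have hinv : (σ⁻¹) ^ (2 * j) * σ ^ (2 * j) = 1 := by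
    rw [inv_pow, inv_mul_cancel₀ (pow_ne_zero _ h.σ_pos.ne')]
  ext ⟨s, x⟩
  simp only [mem_preimage, stAffine_apply, mem_prod, mem_Ico, mem_univ, and_true, switchTime_succ]
  have e : -((σ⁻¹) ^ (2 * j) * switchTime T σ j) + (σ⁻¹) ^ (2 * j) * s =
      (σ⁻¹) ^ (2 * j) * (s - switchTime T σ j) := by ring
  rw [e]
  constructor
  · rintro ⟨h1, h2⟩
    refine ⟨by nlinarith [mul_nonneg_iff_of_pos_left hβ |>.1 h1], ?_⟩
    have h3 : (σ⁻¹) ^ (2 * j) * (s - switchTime T σ j) * σ ^ (2 * j) < T * σ ^ (2 * j) :=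
      mul_lt_mul_of_pos_right h2 (pow_pos h.σ_pos _)
    have h4 : (σ⁻¹) ^ (2 * j) * (s - switchTime T σ j) * σ ^ (2 * j) = s - switchTime T σ j := by
      rw [mul_comm ((σ⁻¹) ^ (2 * j)), mul_assoc, hinv, mul_one]
    linarith
  · rintro ⟨h1, h2⟩
    refine ⟨mul_nonneg hβ.le (by linarith), ?_⟩
    calc (σ⁻¹) ^ (2 * j) * (s - switchTime T σ j)
        < (σ⁻¹) ^ (2 * j) * (T * σ ^ (2 * j)) := mul_lt_mul_of_pos_left (by linarith) hβ
      _ = T := by rw [mul_comm T, ← mul_assoc, hinv, one_mul]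

/-- **The Jacobian factor of the `j`-th affine map is `(a⁻¹τ⁴)ʲ`**:
`(σ^{-2j} (τ^{-j})³)⁻¹ = (aʲτ^{-4j})⁻¹`. [cite: Scheffer1985, proof of Lemma 2.3 (2.34)] -/
theorem jacobian_eq (h : IsSuperBlock T ν₀ τ σ a z G u) (j : ℕ) :
    ((σ⁻¹) ^ (2 * j) * ((τ⁻¹) ^ j) ^ finrank ℝ (EuclideanSpace ℝ (Fin 3)))⁻¹ = (a⁻¹ * τ ^ 4) ^ j := by
  rw [finrank_euclideanSpace_fin, h.inv_σ_pow_two_mul]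
  have e : a ^ j * (τ⁻¹) ^ j * ((τ⁻¹) ^ j) ^ 3 = (a * (τ⁻¹) ^ 4) ^ j := by ring
  rw [e, ← inv_pow, mul_inv, inv_pow, inv_inv]

/-! ### The glued field on the strips as rescaled pull-backs -/

/-- On the `j`-th strip the glued field is the rescaled pull-back `aʲ u ∘ Φⱼ`. [cite: Ozanski2017NSISingular, §2 (2.4)] -/
theorem glueG_eq_smul_stPull (h : IsSuperBlock T ν₀ τ σ a z G u) {j : ℕ} {s : ℝ}
    (hs : s ∈ Ico (switchTime T σ j) (switchTime T σ (j + 1))) (x : EuclideanSpace ℝ (Fin 3)) :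
    glueG T σ τ a z u s x = (a ^ j • stPull ((σ⁻¹) ^ (2 * j)) ((τ⁻¹) ^ j)
      (-((σ⁻¹) ^ (2 * j) * switchTime T σ j)) ((1 - (τ⁻¹) ^ j) • (1 - τ)⁻¹ • z) u) s x := by
  rw [glueG_eq_pieceG h.T_pos h.σ_pos τ a z u hs]
  rfl

/-- On the `j`-th strip the slice derivative of the glued field is `aʲτ^{-j} Du ∘ Φⱼ`. [cite: Scheffer1985, proof of Lemma 2.3 (2.34)] -/
theorem fderiv_glueG_eq_smul_stPull (h : IsSuperBlock T ν₀ τ σ a z G u) {j : ℕ} {s : ℝ}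
    (hs : s ∈ Ico (switchTime T σ j) (switchTime T σ (j + 1))) (x : EuclideanSpace ℝ (Fin 3)) :
    fderiv ℝ (glueG T σ τ a z u s) x = ((a ^ j * (τ⁻¹) ^ j) • stPull ((σ⁻¹) ^ (2 * j)) ((τ⁻¹) ^ j)
      (-((σ⁻¹) ^ (2 * j) * switchTime T σ j)) ((1 - (τ⁻¹) ^ j) • (1 - τ)⁻¹ • z)
        (fun r y => fderiv ℝ (u r) y)) s x := by
  rw [glueG_eq_pieceG h.T_pos h.σ_pos τ a z u hs]
  have hs' := h.localTime_mem (Ico_subset_Icc_self hs)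
  have hu1 : ContDiff ℝ 1 (u (-((σ⁻¹) ^ (2 * j) * switchTime T σ j) + (σ⁻¹) ^ (2 * j) * s)) :=
    (h.block.contDiff_slice hs').of_le (by norm_cast)
  have hd : DifferentiableAt ℝ (stPull ((σ⁻¹) ^ (2 * j)) ((τ⁻¹) ^ j)
      (-((σ⁻¹) ^ (2 * j) * switchTime T σ j)) ((1 - (τ⁻¹) ^ j) • (1 - τ)⁻¹ • z) u s) x :=
    differentiable_stPull_slice (hu1.differentiable (by simp)) x
  rw [pieceG, show (a ^ j • stPull ((σ⁻¹) ^ (2 * j)) ((τ⁻¹) ^ j)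
      (-((σ⁻¹) ^ (2 * j) * switchTime T σ j)) ((1 - (τ⁻¹) ^ j) • (1 - τ)⁻¹ • z) u) s =
      a ^ j • stPull ((σ⁻¹) ^ (2 * j)) ((τ⁻¹) ^ j)
        (-((σ⁻¹) ^ (2 * j) * switchTime T σ j)) ((1 - (τ⁻¹) ^ j) • (1 - τ)⁻¹ • z) u s from rfl,
    fderiv_const_smul hd, fderiv_stPull, smul_smul]
  rfl

/-- On the `j`-th strip, `p̃[𝔲(s)](x) ‖𝔲(s,x)‖ = a^{3j} (p̃[u] ‖u‖)(Φⱼ(s,x))`. [cite: Scheffer1985, proof of Lemma 2.3 (2.34)] -/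
theorem pressure_mul_norm_glueG_eq_smul_stPull (h : IsSuperBlock T ν₀ τ σ a z G u) {j : ℕ} {s : ℝ}
    (hs : s ∈ Ico (switchTime T σ j) (switchTime T σ (j + 1))) (x : EuclideanSpace ℝ (Fin 3)) :
    normalisedPressure (glueG T σ τ a z u s) x * ‖glueG T σ τ a z u s x‖ =
      (((a ^ j) ^ 3) • stPull ((σ⁻¹) ^ (2 * j)) ((τ⁻¹) ^ j)
        (-((σ⁻¹) ^ (2 * j) * switchTime T σ j)) ((1 - (τ⁻¹) ^ j) • (1 - τ)⁻¹ • z)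
        (fun r y => normalisedPressure (u r) y * ‖u r y‖)) s x := by
  rw [glueG_eq_pieceG h.T_pos h.σ_pos τ a z u hs, h.normalisedPressure_pieceG j s x, pieceG_apply]
  simp only [smul_stPull_apply, smul_eq_mul, norm_smul, Real.norm_of_nonneg (h.gain_pow_pos j).le]
  have e : (1 - (τ⁻¹) ^ j) • (1 - τ)⁻¹ • z + (τ⁻¹) ^ j • x =
      (1 - τ)⁻¹ • z + (τ⁻¹) ^ j • (x - (1 - τ)⁻¹ • z) := by
    rw [sub_smul, one_smul, smul_sub, smul_comm ((τ⁻¹) ^ j) ((1 - τ)⁻¹) z]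
    abel
  rw [e]
  ring

/-! ### The strip integrals -/

/-- **Strip integral of powers of the glued field**:
`∫⁻_{[t_j,t_{j+1}) × EuclideanSpace ℝ (Fin 3)} ‖𝔲‖ₑⁿ = (aⁿa⁻¹τ⁴)ʲ ∫⁻_{[0,T) × EuclideanSpace ℝ (Fin 3)} ‖u‖ₑⁿ`. [cite: Scheffer1985, proof of Lemma 2.3 (2.34)] -/
theorem setLIntegral_strip_enorm_glueG_pow (h : IsSuperBlock T ν₀ τ σ a z G u) (j n : ℕ) :
    ∫⁻ q in Ico (switchTime T σ j) (switchTime T σ (j + 1)) ×ˢ (univ : Set (EuclideanSpace ℝ (Fin 3))),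
        ‖glueG T σ τ a z u q.1 q.2‖ₑ ^ n =
      ENNReal.ofReal ((a ^ n * a⁻¹ * τ ^ 4) ^ j) *
        ∫⁻ q in Ico 0 T ×ˢ (univ : Set (EuclideanSpace ℝ (Fin 3))), ‖u q.1 q.2‖ₑ ^ n := by
  rw [setLIntegral_congr_fun (measurableSet_Ico.prod MeasurableSet.univ)
    (fun q hq => by rw [h.glueG_eq_smul_stPull (mem_prod.1 hq).1 q.2]), ← h.preimage_stAffine_eq_strip j,
    setLIntegral_enorm_pow_stRescale (h.inv_σ_pow_pos _) (h.inv_tau_pow_pos _), h.jacobian_eq,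
    Real.enorm_eq_ofReal (h.gain_pow_pos j).le, ← ENNReal.ofReal_pow (h.gain_pow_pos j).le,
    ← ENNReal.ofReal_mul (pow_nonneg (h.gain_pow_pos j).le n), scalar_pow]

/-- **Strip integral of the slice derivative**:
`∫⁻_{[t_j,t_{j+1}) × EuclideanSpace ℝ (Fin 3)} ‖D𝔲‖ₑ = (τ³)ʲ ∫⁻_{[0,T) × EuclideanSpace ℝ (Fin 3)} ‖Du‖ₑ`. [cite: Scheffer1985, proof of Lemma 2.3 (2.34)] -/
theorem setLIntegral_strip_enorm_fderiv_glueG (h : IsSuperBlock T ν₀ τ σ a z G u) (j : ℕ) :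
    ∫⁻ q in Ico (switchTime T σ j) (switchTime T σ (j + 1)) ×ˢ (univ : Set (EuclideanSpace ℝ (Fin 3))),
        ‖fderiv ℝ (glueG T σ τ a z u q.1) q.2‖ₑ =
      ENNReal.ofReal ((τ ^ 3) ^ j) *
        ∫⁻ q in Ico 0 T ×ˢ (univ : Set (EuclideanSpace ℝ (Fin 3))), ‖fderiv ℝ (u q.1) q.2‖ₑ := by
  have h1 := setLIntegral_enorm_pow_stRescale (F := EuclideanSpace ℝ (Fin 3) →L[ℝ] EuclideanSpace ℝ (Fin 3))
    (h.inv_σ_pow_pos (2 * j)) (h.inv_tau_pow_pos j) (-((σ⁻¹) ^ (2 * j) * switchTime T σ j))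
    ((1 - (τ⁻¹) ^ j) • (1 - τ)⁻¹ • z) (a ^ j * (τ⁻¹) ^ j) (fun r y => fderiv ℝ (u r) y)
    (Ico 0 T ×ˢ univ) 1
  simp only [pow_one] at h1
  have hc : 0 < a ^ j * (τ⁻¹) ^ j := mul_pos (h.gain_pow_pos j) (h.inv_tau_pow_pos j)
  rw [setLIntegral_congr_fun (measurableSet_Ico.prod MeasurableSet.univ)
    (fun q hq => by rw [h.fderiv_glueG_eq_smul_stPull (mem_prod.1 hq).1 q.2]),
    ← h.preimage_stAffine_eq_strip j, h1, h.jacobian_eq, Real.enorm_eq_ofReal hc.le,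
    ← ENNReal.ofReal_mul hc.le, h.scalar_fderiv j]

/-- **Strip integral of the dissipation**:
`∫⁻_{[t_j,t_{j+1}) × EuclideanSpace ℝ (Fin 3)} |D𝔲|² = (aτ²)ʲ ∫⁻_{[0,T) × EuclideanSpace ℝ (Fin 3)} |Du|²`. [cite: Ozanski2017NSISingular, §2 p. 7] -/
theorem setLIntegral_strip_frobeniusNormSq_glueG (h : IsSuperBlock T ν₀ τ σ a z G u) (j : ℕ) :
    ∫⁻ q in Ico (switchTime T σ j) (switchTime T σ (j + 1)) ×ˢ (univ : Set (EuclideanSpace ℝ (Fin 3))),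
        ENNReal.ofReal (frobeniusNormSq (fderiv ℝ (glueG T σ τ a z u q.1) q.2)) =
      ENNReal.ofReal ((a * τ ^ 2) ^ j) *
        ∫⁻ q in Ico 0 T ×ˢ (univ : Set (EuclideanSpace ℝ (Fin 3))), ENNReal.ofReal (frobeniusNormSq (fderiv ℝ (u q.1) q.2)) := by
  have hc : 0 < a ^ j * (τ⁻¹) ^ j := mul_pos (h.gain_pow_pos j) (h.inv_tau_pow_pos j)
  rw [setLIntegral_congr_fun (measurableSet_Ico.prod MeasurableSet.univ)
    (fun q hq => by rw [h.fderiv_glueG_eq_smul_stPull (mem_prod.1 hq).1 q.2]),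
    ← h.preimage_stAffine_eq_strip j,
    setLIntegral_frobeniusNormSq_stRescale (h.inv_σ_pow_pos _) (h.inv_tau_pow_pos _), h.jacobian_eq,
    ← ENNReal.ofReal_mul (pow_nonneg hc.le 2), h.scalar_frobenius j]

/-- **Strip integral of the pressure term**:
`∫⁻_{[t_j,t_{j+1}) × EuclideanSpace ℝ (Fin 3)} |p̃[𝔲]| ‖𝔲‖ = (a²τ⁴)ʲ ∫⁻_{[0,T) × EuclideanSpace ℝ (Fin 3)} |p̃[u]| ‖u‖`. [cite: Scheffer1985, proof of Lemma 2.3 (2.34)] -/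
theorem setLIntegral_strip_pressure_mul_norm_glueG (h : IsSuperBlock T ν₀ τ σ a z G u) (j : ℕ) :
    ∫⁻ q in Ico (switchTime T σ j) (switchTime T σ (j + 1)) ×ˢ (univ : Set (EuclideanSpace ℝ (Fin 3))),
        ‖normalisedPressure (glueG T σ τ a z u q.1) q.2 * ‖glueG T σ τ a z u q.1 q.2‖‖ₑ =
      ENNReal.ofReal ((a ^ 2 * τ ^ 4) ^ j) *
        ∫⁻ q in Ico 0 T ×ˢ (univ : Set (EuclideanSpace ℝ (Fin 3))), ‖normalisedPressure (u q.1) q.2 * ‖u q.1 q.2‖‖ₑ := by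
  have h1 := setLIntegral_enorm_pow_stRescale (F := ℝ)
    (h.inv_σ_pow_pos (2 * j)) (h.inv_tau_pow_pos j) (-((σ⁻¹) ^ (2 * j) * switchTime T σ j))
    ((1 - (τ⁻¹) ^ j) • (1 - τ)⁻¹ • z) ((a ^ j) ^ 3)
    (fun r y => normalisedPressure (u r) y * ‖u r y‖) (Ico 0 T ×ˢ univ) 1
  simp only [pow_one] at h1
  rw [setLIntegral_congr_fun (measurableSet_Ico.prod MeasurableSet.univ)
    (fun q hq => by rw [h.pressure_mul_norm_glueG_eq_smul_stPull (mem_prod.1 hq).1 q.2]),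
    ← h.preimage_stAffine_eq_strip j, h1, h.jacobian_eq,
    Real.enorm_eq_ofReal (pow_pos (h.gain_pow_pos j) 3).le,
    ← ENNReal.ofReal_mul (pow_pos (h.gain_pow_pos j) 3).le, h.scalar_pressure j]

/-! ### Space–time integrability of the glued field -/

/-- **Space–time integrals of the glued field are sums over the strips.** [cite: Ozanski2017NSISingular, §2 p. 7] -/
theorem lintegral_eq_tsum_strip (h : IsSuperBlock T ν₀ τ σ a z G u) {H : ℝ × EuclideanSpace ℝ (Fin 3) → ℝ≥0∞}
    (hH0 : ∀ q : ℝ × EuclideanSpace ℝ (Fin 3), q.1 ∉ Ico 0 (blowupTime T σ) → H q = 0) :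
    ∫⁻ q, H q = ∑' j : ℕ, ∫⁻ q in Ico (switchTime T σ j) (switchTime T σ (j + 1)) ×ˢ (univ : Set (EuclideanSpace ℝ (Fin 3))), H q := by
  have hU := iUnion_strip_eq (E := EuclideanSpace ℝ (Fin 3)) (strictMono_switchTime h.T_pos h.σ_pos)
    (tendsto_switchTime h.σ_pos.le h.σ_lt_one)
  rw [switchTime_zero] at hU
  rw [← lintegral_iUnion (measurableSet_strip (E := EuclideanSpace ℝ (Fin 3)))
    (pairwise_disjoint_strip (strictMono_switchTime h.T_pos h.σ_pos)), hU]
  refine (setLIntegral_eq_of_support_subset fun q hq => ?_).symm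
  by_contra hq'
  exact hq (hH0 q fun h' => hq' ⟨h', mem_univ _⟩)

/-- Off `[0, T₀)` the glued field vanishes. [cite: Scheffer1985, proof of Lemma 2.3 (2.34)] -/
theorem glueG_eq_zero_of_notMem (h : IsSuperBlock T ν₀ τ σ a z G u) {s : ℝ} (hs : s ∉ Ico 0 (blowupTime T σ)) :
    glueG T σ τ a z u s = 0 := by
  by_cases h0 : 0 ≤ s
  · exact glueG_eq_zero_of_le h.T_pos h.σ_pos h.σ_lt_one τ a z u (not_lt.1 fun h' => hs ⟨h0, h'⟩)
  · exact glueG_eq_zero_of_neg h.T_pos h.σ_pos τ a z u (not_le.1 h0)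

/-- **`|𝔲|ⁿ ∈ L¹(ℝ × EuclideanSpace ℝ (Fin 3))` for `1 ≤ n ≤ 3`** (`Σⱼ (aⁿ⁻¹τ⁴)ʲ < ∞`). [cite: Scheffer1985, proof of Lemma 2.3 (2.34)] -/
theorem lintegral_enorm_glueG_pow_lt_top (h : IsSuperBlock T ν₀ τ σ a z G u) {n : ℕ} (hn1 : 1 ≤ n) (hn : n ≤ 3) :
    ∫⁻ q : ℝ × EuclideanSpace ℝ (Fin 3), ‖glueG T σ τ a z u q.1 q.2‖ₑ ^ n < ⊤ := by
  rw [h.lintegral_eq_tsum_strip fun q hq => by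
    simp [h.glueG_eq_zero_of_notMem hq, zero_pow (Nat.one_le_iff_ne_zero.1 hn1)]]
  simp_rw [h.setLIntegral_strip_enorm_glueG_pow]
  rw [ENNReal.tsum_mul_right]
  refine ENNReal.mul_lt_top ?_ (h.block.base_lt_top_norm_pow (Nat.one_le_iff_ne_zero.1 hn1))
  exact IsNSIBlock.tsum_ofReal_pow_lt_top (h.pow_ratio_nonneg n) (h.pow_ratio_lt_one hn)

/-- Off `[0, T₀)` the slice derivative of the glued field vanishes. [cite: Scheffer1985, proof of Lemma 2.3 (2.34)] -/
theorem fderiv_glueG_eq_zero_of_notMem (h : IsSuperBlock T ν₀ τ σ a z G u) {s : ℝ}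
    (hs : s ∉ Ico 0 (blowupTime T σ)) (x : EuclideanSpace ℝ (Fin 3)) : fderiv ℝ (glueG T σ τ a z u s) x = 0 := by
  rw [h.glueG_eq_zero_of_notMem hs]
  exact fderiv_const_apply _

/-- **`D𝔲 ∈ L¹(ℝ × EuclideanSpace ℝ (Fin 3))`** (`Σⱼ τ^{3j} < ∞`). [cite: Scheffer1985, proof of Lemma 2.3 (2.34)] -/
theorem lintegral_enorm_fderiv_glueG_lt_top (h : IsSuperBlock T ν₀ τ σ a z G u) :
    ∫⁻ q : ℝ × EuclideanSpace ℝ (Fin 3), ‖fderiv ℝ (glueG T σ τ a z u q.1) q.2‖ₑ < ⊤ := by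
  rw [h.lintegral_eq_tsum_strip fun q hq => by
    rw [h.fderiv_glueG_eq_zero_of_notMem hq, ← ofReal_norm, norm_zero, ENNReal.ofReal_zero]]
  simp_rw [h.setLIntegral_strip_enorm_fderiv_glueG]
  rw [ENNReal.tsum_mul_right]
  refine ENNReal.mul_lt_top ?_ h.block.base_lt_top_fderiv
  exact IsNSIBlock.tsum_ofReal_pow_lt_top (pow_nonneg h.τ_pos.le 3) h.pow_three_lt_one

/-- **`|D𝔲|² ∈ L¹(ℝ × EuclideanSpace ℝ (Fin 3))`** (`Σⱼ (aτ²)ʲ < ∞`). [cite: Ozanski2017NSISingular, §2 p. 7] -/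
theorem lintegral_frobeniusNormSq_glueG_lt_top (h : IsSuperBlock T ν₀ τ σ a z G u) :
    ∫⁻ q : ℝ × EuclideanSpace ℝ (Fin 3), ENNReal.ofReal (frobeniusNormSq (fderiv ℝ (glueG T σ τ a z u q.1) q.2)) < ⊤ := by
  rw [h.lintegral_eq_tsum_strip fun q hq => by
    simp [h.fderiv_glueG_eq_zero_of_notMem hq, frobeniusNormSq_zero]]
  simp_rw [h.setLIntegral_strip_frobeniusNormSq_glueG]
  rw [ENNReal.tsum_mul_right]
  exact ENNReal.mul_lt_top (IsNSIBlock.tsum_ofReal_pow_lt_top (mul_nonneg h.gain_pos.le (sq_nonneg τ))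
    h.gain_mul_sq_lt_one) h.block.base_lt_top_frobeniusNormSq

/-- **`|p̃[𝔲]|‖𝔲‖ ∈ L¹(ℝ × EuclideanSpace ℝ (Fin 3))`** (`Σⱼ (a²τ⁴)ʲ < ∞`). [cite: Scheffer1985, proof of Lemma 2.3 (2.34)] -/
theorem lintegral_pressure_mul_norm_glueG_lt_top (h : IsSuperBlock T ν₀ τ σ a z G u) :
    ∫⁻ q : ℝ × EuclideanSpace ℝ (Fin 3), ‖normalisedPressure (glueG T σ τ a z u q.1) q.2 * ‖glueG T σ τ a z u q.1 q.2‖‖ₑ < ⊤ := by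
  rw [h.lintegral_eq_tsum_strip fun q hq => by simp [h.glueG_eq_zero_of_notMem hq]]
  simp_rw [h.setLIntegral_strip_pressure_mul_norm_glueG]
  rw [ENNReal.tsum_mul_right]
  refine ENNReal.mul_lt_top ?_ h.block.base_lt_top_pressure_mul_norm
  exact IsNSIBlock.tsum_ofReal_pow_lt_top (mul_nonneg (sq_nonneg a) (pow_nonneg h.τ_pos.le 4))
    h.gain_sq_mul_pow_four_lt_one

end IsSuperBlock

end Literature.Barriers.NavierStokesRegularity.NSISuperCascade

end Part5

/-!
## Part 6 — port of `Summits/NavierStokesRegularity/NavierStokesRegularity/Theorems/TypeIliouvilleNoTypeII/Negative/NSISuperCascadeWeak.lean` (16 declarations kept)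

# The super-similar switching cascade, III: a weak solution of the Navier–Stokes inequality

Negative-lane support for `Summit.NavierStokesRegularity.NavierStokesRegularity.Theses.TypeILiouville.TypeIliouvilleNoTypeII`
: last part of brick **B2** (the spine) of the kernel
discharge of `Literature.Barriers.NavierStokesRegularity.NSITypeIIBlowup`, the parametrised copy
of the tree's `SchefferSwitchedIntegrability` (measurability, packaging, energy) and
`SchefferSwitchedSolution` for the generalised switched field `glueG T σ τ a z u` under
`IsSuperBlock T ν₀ τ σ a z G u`.

* a.e.-strong measurability of `𝔲`, `D𝔲`, `p̃[𝔲]` from piecewise continuity on the strips;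
* `𝔲, D𝔲 ∈ L¹((0,∞) × EuclideanSpace ℝ (Fin 3))`, `|𝔲|², |𝔲|³, |p̃[𝔲]|‖𝔲‖, |D𝔲|² ∈ L¹((0,∞) × EuclideanSpace ℝ (Fin 3))`;
* the energy bound `∫|𝔲(t)|² ≤ (a²τ³)ʲ sup_{[0,T]} ∫|u|² ≤ sup_{[0,T]} ∫|u|²` — the one place
  where the ENERGY CAP `a²τ³ ≤ 1` of `IsSuperBlock` is used;
* `IsSuperBlock.isWeakNSISolution_glueG` — **the super-similar glued field is a weak solution of
  the Navier–Stokes inequality for every `ν ∈ [0, ν₀]`**, by the generic gluing principle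
  `isWeakNSISolution_of_piecewise` (pieces `pieceG … j`, pressures `p̃[pieceG … j s]`, slice
  derivatives; the drop hypothesis is the super-gain, `norm_pieceG_succ_le`);
* `C^∞` slices supported in `G` for every `t` (`contDiff_glueG_slice`, `tsupport_glueG_slice_subset`).

The remaining clauses of `NSITypeIIBlowup` (singular point `(T₀, x₀)`, boundedness before `T₀`,
the rate `β = log a / log σ⁻² > 1/2`) are field-level and off this spine.
[cite: Ozanski2017NSISingular, §2 pp. 6–7] [cite: Scheffer1985, Lemma 2.3]; the two-parameter
bookkeeping is [folklore].

(Verbatim declaration-level port — the declarations listed in the Part header count — of the Summits-side module of the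
NavierStokesRegularity tree (negative lane of `TypeIliouvilleNoTypeII`); route / lane bookkeeping in the text above is historical.)
-/

section Part6

open _root_.MeasureTheory _root_.Set _root_.Function _root_.Filter _root_.Topology _root_.TopologicalSpace _root_.Metric _root_.Module
open scoped _root_.ENNReal _root_.InnerProductSpace RealInnerProductSpace _root_.ContDiff Laplacian

namespace Literature.Barriers.NavierStokesRegularity.NSISuperCascade

open Literature.Analysis.FluidPDE Literature.Barriers.NavierStokesRegularity
open Literature.Barriers.NavierStokesRegularity.Scheffer

namespace IsSuperBlock

variable {T ν₀ τ σ a : ℝ} {z : EuclideanSpace ℝ (Fin 3)} {G : Set (EuclideanSpace ℝ (Fin 3))} {u : ℝ → EuclideanSpace ℝ (Fin 3) → EuclideanSpace ℝ (Fin 3)}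

/-! ### Measurability of the piecewise-continuous fields -/

/-- **A field on `ℝ × EuclideanSpace ℝ (Fin 3)` vanishing off `[0,T₀) × EuclideanSpace ℝ (Fin 3)` and agreeing on each strip with a field
continuous on the closed strip is a.e.-strongly measurable.** [cite: Ozanski2017NSISingular, §2 p. 7] -/
theorem aestronglyMeasurable_of_strips (h : IsSuperBlock T ν₀ τ σ a z G u) {X : Type*} [NormedAddCommGroup X]
    [NormedSpace ℝ X] {f : ℝ × EuclideanSpace ℝ (Fin 3) → X}
    (hf0 : ∀ q : ℝ × EuclideanSpace ℝ (Fin 3), q.1 ∉ Ico 0 (blowupTime T σ) → f q = 0)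
    (F : ℕ → ℝ × EuclideanSpace ℝ (Fin 3) → X)
    (hF : ∀ j, ContinuousOn (F j) (Icc (switchTime T σ j) (switchTime T σ (j + 1)) ×ˢ univ))
    (hfF : ∀ j (q : ℝ × EuclideanSpace ℝ (Fin 3)), q.1 ∈ Ico (switchTime T σ j) (switchTime T σ (j + 1)) → f q = F j q) :
    AEStronglyMeasurable f (volume : Measure (ℝ × EuclideanSpace ℝ (Fin 3))) := by
  have hU := iUnion_strip_eq (E := EuclideanSpace ℝ (Fin 3)) (strictMono_switchTime h.T_pos h.σ_pos)
    (tendsto_switchTime h.σ_pos.le h.σ_lt_one)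
  rw [switchTime_zero] at hU
  -- on the union of the strips
  have h1 : AEStronglyMeasurable f (volume.restrict (Ico 0 (blowupTime T σ) ×ˢ (univ : Set (EuclideanSpace ℝ (Fin 3))))) := by
    rw [← hU, aestronglyMeasurable_iUnion_iff]
    intro j
    have hFj : AEStronglyMeasurable (F j) (volume.restrict
        (Ico (switchTime T σ j) (switchTime T σ (j + 1)) ×ˢ (univ : Set (EuclideanSpace ℝ (Fin 3))))) :=
      ((hF j).mono (prod_mono Ico_subset_Icc_self Subset.rfl)).aestronglyMeasurable
        (measurableSet_Ico.prod MeasurableSet.univ)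
    refine hFj.congr ?_
    filter_upwards [ae_restrict_mem (measurableSet_Ico.prod MeasurableSet.univ)] with q hq
    exact (hfF j q (mem_prod.1 hq).1).symm
  -- on the complement the field vanishes
  have h2 : AEStronglyMeasurable f (volume.restrict (Ico 0 (blowupTime T σ) ×ˢ (univ : Set (EuclideanSpace ℝ (Fin 3))))ᶜ) := by
    refine (aestronglyMeasurable_const (b := (0 : X))).congr ?_
    filter_upwards [ae_restrict_mem (measurableSet_Ico.prod MeasurableSet.univ).compl] with q hq
    exact (hf0 q fun h' => hq ⟨h', mem_univ _⟩).symm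
  have h3 := (aestronglyMeasurable_union_iff (μ := (volume : Measure (ℝ × EuclideanSpace ℝ (Fin 3))))
    (s := Ico 0 (blowupTime T σ) ×ˢ (univ : Set (EuclideanSpace ℝ (Fin 3)))) (t := (Ico 0 (blowupTime T σ) ×ˢ (univ : Set (EuclideanSpace ℝ (Fin 3))))ᶜ)).2
    ⟨h1, h2⟩
  rwa [union_compl_self, Measure.restrict_univ] at h3

/-- `(s, x) ↦ u^{(j)}(s, x)` is continuous on the closed `j`-th strip. [cite: Ozanski2017NSISingular, §2 p. 7] -/
theorem continuousOn_uncurry_pieceG (h : IsSuperBlock T ν₀ τ σ a z G u) (j : ℕ) :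
    ContinuousOn (uncurry (pieceG T σ τ a z u j)) (Icc (switchTime T σ j) (switchTime T σ (j + 1)) ×ˢ univ) := by
  obtain ⟨η, hη, hsm⟩ := h.isSmoothSpaceTimeOn_pieceG j
  exact hsm.continuousOn.mono (prod_mono (Icc_switchTime_subset_preimage h.σ_pos hη j) Subset.rfl)

/-- `(s, x) ↦ D u^{(j)}(s)(x)` is continuous on the closed `j`-th strip. [cite: Ozanski2017NSISingular, §2 p. 7] -/
theorem continuousOn_fderiv_pieceG (h : IsSuperBlock T ν₀ τ σ a z G u) (j : ℕ) :
    ContinuousOn (fun q : ℝ × EuclideanSpace ℝ (Fin 3) => fderiv ℝ (pieceG T σ τ a z u j q.1) q.2)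
      (Icc (switchTime T σ j) (switchTime T σ (j + 1)) ×ˢ univ) := by
  obtain ⟨η, hη, hsm⟩ := h.isSmoothSpaceTimeOn_pieceG j
  have hopen : IsOpen ((fun r => -((σ⁻¹) ^ (2 * j) * switchTime T σ j) + (σ⁻¹) ^ (2 * j) * r) ⁻¹'
      Ioo (-η) (T + η)) := isOpen_Ioo.preimage (by fun_prop)
  have h1 := continuousOn_fderiv_slice_of_contDiffOn (hsm.of_le (by
    change ((1 : ℕ∞) : WithTop ℕ∞) ≤ ((⊤ : ℕ∞) : WithTop ℕ∞); exact_mod_cast le_top)) hopen.uniqueDiffOn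
  exact h1.mono (prod_mono (Icc_switchTime_subset_preimage h.σ_pos hη j) Subset.rfl)

/-- **`𝔲` is a.e.-strongly measurable on `ℝ × EuclideanSpace ℝ (Fin 3)`.** [cite: Ozanski2017NSISingular, §2 p. 7] -/
theorem aestronglyMeasurable_glueG (h : IsSuperBlock T ν₀ τ σ a z G u) :
    AEStronglyMeasurable (fun q : ℝ × EuclideanSpace ℝ (Fin 3) => glueG T σ τ a z u q.1 q.2) (volume : Measure (ℝ × EuclideanSpace ℝ (Fin 3))) :=
  h.aestronglyMeasurable_of_strips (fun q hq => by rw [h.glueG_eq_zero_of_notMem hq]; rfl)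
    (fun j => uncurry (pieceG T σ τ a z u j)) h.continuousOn_uncurry_pieceG
    fun j q hq => by rw [glueG_eq_pieceG h.T_pos h.σ_pos τ a z u hq]; rfl

/-- **`D𝔲` is a.e.-strongly measurable on `ℝ × EuclideanSpace ℝ (Fin 3)`.** [cite: Ozanski2017NSISingular, §2 p. 7] -/
theorem aestronglyMeasurable_fderiv_glueG (h : IsSuperBlock T ν₀ τ σ a z G u) :
    AEStronglyMeasurable (fun q : ℝ × EuclideanSpace ℝ (Fin 3) => fderiv ℝ (glueG T σ τ a z u q.1) q.2) (volume : Measure (ℝ × EuclideanSpace ℝ (Fin 3))) :=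
  h.aestronglyMeasurable_of_strips (fun q hq => h.fderiv_glueG_eq_zero_of_notMem hq q.2)
    (fun j q => fderiv ℝ (pieceG T σ τ a z u j q.1) q.2) h.continuousOn_fderiv_pieceG
    fun j q hq => by simp only [glueG_eq_pieceG h.T_pos h.σ_pos τ a z u hq]

/-- **`p̃[𝔲]` is a.e.-strongly measurable on `ℝ × EuclideanSpace ℝ (Fin 3)`.** [cite: Ozanski2017NSISingular, §2 p. 7] -/
theorem aestronglyMeasurable_pressure_glueG (h : IsSuperBlock T ν₀ τ σ a z G u) :
    AEStronglyMeasurable (fun q : ℝ × EuclideanSpace ℝ (Fin 3) => normalisedPressure (glueG T σ τ a z u q.1) q.2)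
      (volume : Measure (ℝ × EuclideanSpace ℝ (Fin 3))) :=
  h.aestronglyMeasurable_of_strips
    (fun q hq => by simp only [h.glueG_eq_zero_of_notMem hq, normalisedPressure_zero, Pi.zero_apply])
    (fun j q => normalisedPressure (pieceG T σ τ a z u j q.1) q.2) h.continuousOn_normalisedPressure_pieceG
    fun j q hq => by simp only [glueG_eq_pieceG h.T_pos h.σ_pos τ a z u hq]

/-! ### Packaging: integrability on `(0,∞) × EuclideanSpace ℝ (Fin 3)` -/

/-- **`𝔲 ∈ L¹((0,∞) × EuclideanSpace ℝ (Fin 3))`.** [cite: Ozanski2017NSISingular, §2 p. 7] -/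
theorem integrableOn_glueG (h : IsSuperBlock T ν₀ τ σ a z G u) :
    IntegrableOn (uncurry (glueG T σ τ a z u)) ((positiveTimes : Opens (ℝ × EuclideanSpace ℝ (Fin 3))) : Set (ℝ × EuclideanSpace ℝ (Fin 3))) volume := by
  rw [Function.uncurry_def]
  refine Integrable.integrableOn ⟨h.aestronglyMeasurable_glueG, ?_⟩
  rw [hasFiniteIntegral_iff_enorm]
  have h1 := h.lintegral_enorm_glueG_pow_lt_top le_rfl (by norm_num : 1 ≤ 3)
  simp only [pow_one] at h1
  exact h1

/-- **`D𝔲 ∈ L¹((0,∞) × EuclideanSpace ℝ (Fin 3))`.** [cite: Ozanski2017NSISingular, §2 p. 7] -/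
theorem integrableOn_fderiv_glueG (h : IsSuperBlock T ν₀ τ σ a z G u) :
    IntegrableOn (uncurry fun s x => fderiv ℝ (glueG T σ τ a z u s) x)
      ((positiveTimes : Opens (ℝ × EuclideanSpace ℝ (Fin 3))) : Set (ℝ × EuclideanSpace ℝ (Fin 3))) volume := by
  rw [Function.uncurry_def]
  refine Integrable.integrableOn ⟨h.aestronglyMeasurable_fderiv_glueG, ?_⟩
  rw [hasFiniteIntegral_iff_enorm]
  exact h.lintegral_enorm_fderiv_glueG_lt_top

/-- **`|𝔲|² ∈ L¹((0,∞) × EuclideanSpace ℝ (Fin 3))`.** [cite: Ozanski2017NSISingular, §2 p. 7] -/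
theorem integrable_norm_glueG_sq (h : IsSuperBlock T ν₀ τ σ a z G u) :
    Integrable (fun q : ℝ × EuclideanSpace ℝ (Fin 3) => ‖glueG T σ τ a z u q.1 q.2‖ ^ 2)
      (volume.restrict ((positiveTimes : Opens (ℝ × EuclideanSpace ℝ (Fin 3))) : Set (ℝ × EuclideanSpace ℝ (Fin 3)))) := by
  have hm : AEStronglyMeasurable (fun q : ℝ × EuclideanSpace ℝ (Fin 3) => ‖glueG T σ τ a z u q.1 q.2‖ ^ 2) volume :=
    (continuous_norm.pow 2).comp_aestronglyMeasurable h.aestronglyMeasurable_glueG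
  refine Integrable.restrict ⟨hm, ?_⟩
  rw [hasFiniteIntegral_iff_enorm]
  have h1 := h.lintegral_enorm_glueG_pow_lt_top (by norm_num : 1 ≤ 2) (by norm_num : 2 ≤ 3)
  refine lt_of_le_of_lt (le_of_eq (lintegral_congr fun q => ?_)) h1
  rw [Real.enorm_eq_ofReal (by positivity), ENNReal.ofReal_pow (norm_nonneg _), ofReal_norm]

/-- **`|𝔲|³ ∈ L¹((0,∞) × EuclideanSpace ℝ (Fin 3))`.** [cite: Scheffer1985, proof of Lemma 2.3 (2.34)] -/
theorem integrable_norm_glueG_cube (h : IsSuperBlock T ν₀ τ σ a z G u) :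
    Integrable (fun q : ℝ × EuclideanSpace ℝ (Fin 3) => ‖glueG T σ τ a z u q.1 q.2‖ ^ 3)
      (volume.restrict ((positiveTimes : Opens (ℝ × EuclideanSpace ℝ (Fin 3))) : Set (ℝ × EuclideanSpace ℝ (Fin 3)))) := by
  have hm : AEStronglyMeasurable (fun q : ℝ × EuclideanSpace ℝ (Fin 3) => ‖glueG T σ τ a z u q.1 q.2‖ ^ 3) volume :=
    (continuous_norm.pow 3).comp_aestronglyMeasurable h.aestronglyMeasurable_glueG
  refine Integrable.restrict ⟨hm, ?_⟩
  rw [hasFiniteIntegral_iff_enorm]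
  have h1 := h.lintegral_enorm_glueG_pow_lt_top (by norm_num : 1 ≤ 3) le_rfl
  refine lt_of_le_of_lt (le_of_eq (lintegral_congr fun q => ?_)) h1
  rw [Real.enorm_eq_ofReal (by positivity), ENNReal.ofReal_pow (norm_nonneg _), ofReal_norm]

/-- **`|p̃[𝔲]|‖𝔲‖ ∈ L¹((0,∞) × EuclideanSpace ℝ (Fin 3))`.** [cite: Scheffer1985, proof of Lemma 2.3 (2.34)] -/
theorem integrable_pressure_mul_norm_glueG (h : IsSuperBlock T ν₀ τ σ a z G u) :
    Integrable (fun q : ℝ × EuclideanSpace ℝ (Fin 3) => |normalisedPressure (glueG T σ τ a z u q.1) q.2| * ‖glueG T σ τ a z u q.1 q.2‖)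
      (volume.restrict ((positiveTimes : Opens (ℝ × EuclideanSpace ℝ (Fin 3))) : Set (ℝ × EuclideanSpace ℝ (Fin 3)))) := by
  have hm : AEStronglyMeasurable (fun q : ℝ × EuclideanSpace ℝ (Fin 3) =>
      |normalisedPressure (glueG T σ τ a z u q.1) q.2| * ‖glueG T σ τ a z u q.1 q.2‖) volume := by
    exact (h.aestronglyMeasurable_pressure_glueG.norm.congr
      (Eventually.of_forall fun q => Real.norm_eq_abs _)).mul h.aestronglyMeasurable_glueG.norm
  refine Integrable.restrict ⟨hm, ?_⟩
  rw [hasFiniteIntegral_iff_enorm]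
  refine lt_of_le_of_lt (le_of_eq (lintegral_congr fun q => ?_)) h.lintegral_pressure_mul_norm_glueG_lt_top
  rw [enorm_mul, enorm_mul, Real.enorm_abs, enorm_norm]

/-- **`|D𝔲|² ∈ L¹((0,∞) × EuclideanSpace ℝ (Fin 3))`.** [cite: Ozanski2017NSISingular, §2 p. 7] -/
theorem integrable_frobeniusNormSq_glueG (h : IsSuperBlock T ν₀ τ σ a z G u) :
    Integrable (fun q : ℝ × EuclideanSpace ℝ (Fin 3) => frobeniusNormSq (fderiv ℝ (glueG T σ τ a z u q.1) q.2))
      (volume.restrict ((positiveTimes : Opens (ℝ × EuclideanSpace ℝ (Fin 3))) : Set (ℝ × EuclideanSpace ℝ (Fin 3)))) := by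
  have hm : AEStronglyMeasurable
      (fun q : ℝ × EuclideanSpace ℝ (Fin 3) => frobeniusNormSq (fderiv ℝ (glueG T σ τ a z u q.1) q.2)) volume := by
    exact LerayHopfProofs.continuous_frobeniusNormSq.comp_aestronglyMeasurable h.aestronglyMeasurable_fderiv_glueG
  refine Integrable.restrict ⟨hm, ?_⟩
  rw [hasFiniteIntegral_iff_enorm]
  refine lt_of_le_of_lt (le_of_eq (lintegral_congr fun q => ?_)) h.lintegral_frobeniusNormSq_glueG_lt_top
  rw [Real.enorm_eq_ofReal (frobeniusNormSq_nonneg _)]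

/-! ### The energy bound (here the cap `a²τ³ ≤ 1` is used) -/

/-- **The energy of the glued field is bounded**: `∫|𝔲(t)|² ≤ (a²τ³)ʲ sup_{[0,T]} ∫|u|² ≤ sup ∫|u|²`
for `t` on the `j`-th piece. [cite: Ozanski2017NSISingular, §2 p. 7] -/
theorem energy_glueG (h : IsSuperBlock T ν₀ τ σ a z G u) :
    ∃ C : ℝ≥0∞, C < ⊤ ∧ ∀ t : ℝ, 0 < t → ∫⁻ x, ‖glueG T σ τ a z u t x‖ₑ ^ 2 ≤ C := by
  obtain ⟨C, hC, hE⟩ := h.block.exists_energy_bound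
  refine ⟨C, hC, fun t ht => ?_⟩
  by_cases ht' : t < blowupTime T σ
  · obtain ⟨j, hj⟩ := exists_mem_Ico_switchTime h.σ_pos h.σ_lt_one ht.le ht'
    have hs := h.localTime_mem (Ico_subset_Icc_self hj)
    have hγ := h.inv_tau_pow_pos j
    have ha := h.gain_pow_pos j
    rw [glueG_eq_pieceG h.T_pos h.σ_pos τ a z u hj, pieceG_slice_eq_smul_comp_affine]
    have e : ∀ x : EuclideanSpace ℝ (Fin 3), ‖a ^ j •
        u ((σ⁻¹) ^ (2 * j) * (t - switchTime T σ j)) ((1 - (τ⁻¹) ^ j) • (1 - τ)⁻¹ • z + (τ⁻¹) ^ j • x)‖ₑ ^ 2 =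
        ENNReal.ofReal ((a ^ j) ^ 2) *
          ‖u ((σ⁻¹) ^ (2 * j) * (t - switchTime T σ j)) ((1 - (τ⁻¹) ^ j) • (1 - τ)⁻¹ • z + (τ⁻¹) ^ j • x)‖ₑ ^ 2 := by
      intro x
      simp only [enorm_smul, mul_pow, Real.enorm_eq_ofReal ha.le, ENNReal.ofReal_pow ha.le]
    rw [lintegral_congr e,
      lintegral_comp_space_affine hγ ((1 - (τ⁻¹) ^ j) • (1 - τ)⁻¹ • z)
        (fun y => ENNReal.ofReal ((a ^ j) ^ 2) * ‖u ((σ⁻¹) ^ (2 * j) * (t - switchTime T σ j)) y‖ₑ ^ 2),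
      lintegral_const_mul' _ _ ENNReal.ofReal_ne_top,
      ← mul_assoc, ← ENNReal.ofReal_mul (inv_pos.2 (pow_pos hγ _)).le, finrank_euclideanSpace_fin]
    have hcoef : (((τ⁻¹) ^ j) ^ 3)⁻¹ * (a ^ j) ^ 2 = (a ^ 2 * τ ^ 3) ^ j := by
      rw [inv_pow, inv_pow, inv_inv]
      ring
    rw [hcoef]
    have hs' : (σ⁻¹) ^ (2 * j) * (t - switchTime T σ j) ∈ Icc 0 T := by
      convert hs using 1; ring
    calc ENNReal.ofReal ((a ^ 2 * τ ^ 3) ^ j) * ∫⁻ y, ‖u ((σ⁻¹) ^ (2 * j) * (t - switchTime T σ j)) y‖ₑ ^ 2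
        ≤ 1 * ∫⁻ y, ‖u ((σ⁻¹) ^ (2 * j) * (t - switchTime T σ j)) y‖ₑ ^ 2 := by
          gcongr
          exact ENNReal.ofReal_le_one.2 (pow_le_one₀
            (mul_nonneg (sq_nonneg a) (pow_nonneg h.τ_pos.le 3)) h.cap)
      _ ≤ C := by rw [one_mul]; exact hE _ hs'
  · rw [glueG_eq_zero_of_le h.T_pos h.σ_pos h.σ_lt_one τ a z u (not_lt.1 ht')]
    simp

/-! ### The glued field is a weak solution of the Navier–Stokes inequality -/

/-- **The super-similar glued field is a weak solution of the Navier–Stokes inequality** for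
every `ν ∈ [0, ν₀]`, with its pressure function `t ↦ p̃[𝔲(t)]`: the generic gluing principle
`isWeakNSISolution_of_piecewise` applied to the pieces `pieceG … j`, their pressures and slice
derivatives; the drop hypothesis at the switching times is the super-gain
(`norm_pieceG_succ_le`). [cite: Ozanski2017NSISingular, §2 pp. 6–7] [cite: Scheffer1985, Lemma 2.3] -/
theorem isWeakNSISolution_glueG (h : IsSuperBlock T ν₀ τ σ a z G u) {ν : ℝ} (hν : ν ∈ Icc 0 ν₀) :
    IsWeakNSISolution ν (glueG T σ τ a z u) fun s => normalisedPressure (glueG T σ τ a z u s) := by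
  have hmeasp : AEStronglyMeasurable (uncurry fun s => normalisedPressure (glueG T σ τ a z u s))
      (volume.restrict ((positiveTimes : Opens (ℝ × EuclideanSpace ℝ (Fin 3))) : Set (ℝ × EuclideanSpace ℝ (Fin 3)))) := by
    rw [Function.uncurry_def]
    exact h.aestronglyMeasurable_pressure_glueG.restrict
  refine isWeakNSISolution_of_piecewise (t := switchTime T σ) (T₀ := blowupTime T σ)
    (v := fun j => pieceG T σ τ a z u j) (q := fun j s => normalisedPressure (pieceG T σ τ a z u j s))
    (Gr := fun s x => fderiv ℝ (glueG T σ τ a z u s) x)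
    (strictMono_switchTime h.T_pos h.σ_pos) (switchTime_zero T σ)
    (tendsto_switchTime h.σ_pos.le h.σ_lt_one) ?_ ?_ ?_ ?_ ?_ ?_ ?_ h.energy_glueG h.integrableOn_glueG
    h.integrableOn_fderiv_glueG hmeasp h.integrable_norm_glueG_sq h.integrable_norm_glueG_cube
    h.integrable_pressure_mul_norm_glueG h.integrable_frobeniusNormSq_glueG
  · -- agreement on the pieces
    intro j s hs
    have e := glueG_eq_pieceG h.T_pos h.σ_pos τ a z u hs
    exact ⟨e, by simp only [e], by simp only [e]⟩
  · -- vanishing from `T₀` on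
    intro s hs
    have e := glueG_eq_zero_of_le h.T_pos h.σ_pos h.σ_lt_one τ a z u hs
    refine ⟨e, by simp only [e, normalisedPressure_zero], ?_⟩
    funext x
    simp only [e]
    exact fderiv_const_apply _
  · exact fun j s hs => (h.contDiff_pieceG_slice hs).of_le (by norm_cast)
  · exact fun j s hs => h.isDivFree_pieceG (Ico_subset_Icc_self hs)
  · exact fun j x => h.norm_pieceG_succ_le' j x
  · exact fun j φ hφ hφ0 => h.localEnergyIneq_pieceG hν j (hφ.mono le_top) hφ0
  · exact fun j s hs => ⟨h.memLp_normalisedPressure_pieceG (Ico_subset_Icc_self hs),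
      fun ψ hψ => h.poisson_normalisedPressure_pieceG (Ico_subset_Icc_self hs) hψ⟩

/-! ### Slices of the glued field -/

/-- **The slices of the glued field are `C^∞` for every `t`.** [cite: Ozanski2017NSISingular, §2 p. 6] -/
theorem contDiff_glueG_slice (h : IsSuperBlock T ν₀ τ σ a z G u) (t : ℝ) : ContDiff ℝ ∞ (glueG T σ τ a z u t) := by
  by_cases ht : t ∈ Ico 0 (blowupTime T σ)
  · obtain ⟨j, hj⟩ := exists_mem_Ico_switchTime h.σ_pos h.σ_lt_one ht.1 ht.2
    rw [glueG_eq_pieceG h.T_pos h.σ_pos τ a z u hj]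
    exact h.contDiff_pieceG_slice (Ico_subset_Icc_self hj)
  · rw [h.glueG_eq_zero_of_notMem ht]
    exact contDiff_const

/-- **The slices of the glued field are supported in `G` for every `t`.** [cite: Ozanski2017NSISingular, §2 (2.5)] -/
theorem tsupport_glueG_slice_subset (h : IsSuperBlock T ν₀ τ σ a z G u) (t : ℝ) :
    tsupport (glueG T σ τ a z u t) ⊆ G := by
  by_cases ht : t ∈ Ico 0 (blowupTime T σ)
  · obtain ⟨j, hj⟩ := exists_mem_Ico_switchTime h.σ_pos h.σ_lt_one ht.1 ht.2
    rw [glueG_eq_pieceG h.T_pos h.σ_pos τ a z u hj]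
    exact h.tsupport_pieceG_slice_subset (Ico_subset_Icc_self hj)
  · rw [h.glueG_eq_zero_of_notMem ht]
    intro x hx
    rw [tsupport, Function.support_zero, closure_empty] at hx
    exact absurd hx (notMem_empty x)

end IsSuperBlock

end Literature.Barriers.NavierStokesRegularity.NSISuperCascade

end Part6

/-!
## Part 7 — port of `Summits/NavierStokesRegularity/NavierStokesRegularity/Theorems/TypeIliouvilleNoTypeII/Negative/NSISuperCascadeSingular.lean` (8 declarations kept)

# The super-similar NSI cascade: first-blow-up bound, singular point and the super-`1/2` rate (brick B2, off-spine clauses)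

Negative-lane support file for `stmt-NavierStokesRegularity-0056`; the OFF-SPINE clauses of the
barrier fact `Literature.Barriers.NavierStokesRegularity.NSITypeIIBlowup` for the generalised glued
field `𝔲 = glueG T σ τ a z u` of `NSISuperCascadeNotTypeI.lean` (clock `σ`, contraction `τ`,
amplitude `a`; `T₀ = blowupTime T σ`, `x₀ = blowupPoint τ z`), twins of the tree's
`SchefferSwitchedSingular.lean` / `…Integrability.lean` (`exists_bound_norm`) with `τ⁻¹ ↦ a`:

* `exists_bound_glueG` — **`T₀` is the FIRST blow-up time**: `𝔲` is bounded on `[0,T'] × ℝ^3` for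
  every `T' < T₀` (finitely many pieces below `T'`; `a ≥ 1`);
* `not_isRegularPoint_glueG` — **`(T₀, x₀)` is a singular point** (`a > 1`): the `j`-th piece
  equals `aʲu(0,x*)` at `(t_j, Γʲx*) → (T₀, x₀)`; continuity on the closed strip;
* `exists_rate_glueG` — **the super-`1/2` rate** (`aσ > 1`): with `β = log_{σ⁻²} a > 1/2` and some
  `c > 0`, at every `t ∈ [0, T₀)` some point has `‖𝔲(t,x)‖ ≥ c (T₀ - t)^{-β}`; the uniform
  nontriviality `inf_{s ∈ [0,T]} max_y ‖u(s,y)‖ > 0` of the block (`exists_pos_forall_exists_le_norm`)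
  comes from compactness of `[0,T]`, joint continuity and `tsupport u(s) = G ≠ ∅`.

No new definitions; structure-free hypotheses `(h : IsNSIBlock T ν₀ τ z G u) (hσ₀ : 0 < σ) …`;
independent of the spine files (pieces / strips / weak NSI solution, with the slice clause:
ns-typeII-critic-1, `NSISuperCascadePieces/Strips/Weak.lean`) and consumed by name in the assembly
`NSITypeIIBlowupHolds.lean`.

## References

* W. S. Ożański, arXiv:1709.00602 (2017), §2 pp. 6–7, §2.1. [`Ozanski2017NSISingular`]
* V. Scheffer, Comm. Math. Phys. 101 (1985), Lemma 2.3 (2.30). [`Scheffer1985`]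

(Verbatim declaration-level port — the declarations listed in the Part header count — of the Summits-side module of the
NavierStokesRegularity tree (negative lane of `TypeIliouvilleNoTypeII`); route / lane bookkeeping in the text above is historical.)
-/

section Part7

open _root_.Set _root_.Function _root_.Filter _root_.Topology _root_.TopologicalSpace _root_.Metric _root_.MeasureTheory _root_.Module
open scoped _root_.ENNReal _root_.InnerProductSpace RealInnerProductSpace _root_.ContDiff Laplacian

namespace Literature.Barriers.NavierStokesRegularity.NSISuperCascade

open Literature.Analysis.FluidPDE Literature.Barriers.NavierStokesRegularity
open Literature.Barriers.NavierStokesRegularity.Scheffer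
open Literature.Barriers.NavierStokesRegularity.IsNSIBlock

variable {T ν₀ τ σ a : ℝ} {z : EuclideanSpace ℝ (Fin 3)} {G : Set (EuclideanSpace ℝ (Fin 3))}
  {u : ℝ → EuclideanSpace ℝ (Fin 3) → EuclideanSpace ℝ (Fin 3)}

/-! ### Auxiliary facts (private; the public twins live in the spine files) -/

/-- Outside `[0, T₀)` the generalised glued field vanishes (`0 < σ < 1`). [folklore] -/
private theorem glueG_eq_zero_of_notMem_aux (hT : 0 < T) (hσ₀ : 0 < σ) (hσ₁ : σ < 1) (τ a : ℝ)
    (z : EuclideanSpace ℝ (Fin 3)) (u : ℝ → EuclideanSpace ℝ (Fin 3) → EuclideanSpace ℝ (Fin 3))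
    {t : ℝ} (ht : t ∉ Ico 0 (blowupTime T σ)) : glueG T σ τ a z u t = 0 := by
  rcases lt_or_ge t 0 with h0 | h0
  · exact glueG_eq_zero_of_neg hT hσ₀ τ a z u h0
  · exact glueG_eq_zero_of_le hT hσ₀ hσ₁ τ a z u (not_lt.1 fun h1 => ht ⟨h0, h1⟩)

/-- The `j`-th generalised piece is jointly smooth on an open slab around `[t_j, t_{j+1}]`.
[cite: Ozanski2017NSISingular, §2 (2.4)] -/
private theorem isSmoothSpaceTimeOn_pieceG_aux (h : IsNSIBlock T ν₀ τ z G u) (σ a : ℝ) (j : ℕ) :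
    ∃ η : ℝ, 0 < η ∧ IsSmoothSpaceTimeOn
      ((fun r => -((σ⁻¹) ^ (2 * j) * switchTime T σ j) + (σ⁻¹) ^ (2 * j) * r) ⁻¹' Ioo (-η) (T + η))
      (pieceG T σ τ a z u j) := by
  obtain ⟨η, hη, hs⟩ := h.smooth
  exact ⟨η, hη, hs.smul_stPull _ _ _ _ _⟩

/-! ### Values of the pieces on rescaled points; continuity on the closed strips -/

/-- The `j`-th generalised piece on the point `x₀ + τʲ(y - x₀)` is `aʲ u(σ^{-2j}(t - t_j), y)`.
[folklore] -/
private theorem pieceG_apply_center_aux (hτ : τ ≠ 0) (T σ a : ℝ) (z : EuclideanSpace ℝ (Fin 3))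
    (u : ℝ → EuclideanSpace ℝ (Fin 3) → EuclideanSpace ℝ (Fin 3)) (j : ℕ) (t : ℝ)
    (y : EuclideanSpace ℝ (Fin 3)) :
    pieceG T σ τ a z u j t ((1 - τ)⁻¹ • z + τ ^ j • (y - (1 - τ)⁻¹ • z)) =
      a ^ j • u ((σ⁻¹) ^ (2 * j) * (t - switchTime T σ j)) y := by
  rw [pieceG_apply, add_sub_cancel_left, smul_smul, ← mul_pow, inv_mul_cancel₀ hτ, one_pow, one_smul,
    add_sub_cancel]

/-- `(s, x) ↦ u^{(j)}(s, x)` is continuous on the closed `j`-th strip. [folklore] -/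
private theorem continuousOn_uncurry_pieceG_aux (h : IsNSIBlock T ν₀ τ z G u) (hσ : 0 < σ) (a : ℝ)
    (j : ℕ) :
    ContinuousOn (uncurry (pieceG T σ τ a z u j))
      (Icc (switchTime T σ j) (switchTime T σ (j + 1)) ×ˢ univ) := by
  obtain ⟨η, hη, hsm⟩ := isSmoothSpaceTimeOn_pieceG_aux h σ a j
  exact hsm.continuousOn.mono (prod_mono (Icc_switchTime_subset_preimage hσ hη j) Subset.rfl)

/-! ### `T₀` is the first blow-up time -/

/-- **The generalised glued field is bounded on `[0, T'] × ℝ³` for every `T' < T₀`** (`a ≥ 1`):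
only the pieces `j < J` with `T' < t_J` are met, each bounded by `aʲ sup|u| ≤ a^J sup|u|`.
[cite: Ozanski2017NSISingular, §2.1 (p. 6)] -/
theorem exists_bound_glueG (h : IsNSIBlock T ν₀ τ z G u) (hσ₀ : 0 < σ) (hσ₁ : σ < 1) (ha : 1 ≤ a)
    (T' : ℝ) (hT' : T' < blowupTime T σ) :
    ∃ M : ℝ, ∀ t ∈ Icc 0 T', ∀ x, ‖glueG T σ τ a z u t x‖ ≤ M := by
  obtain ⟨M₀, hM₀, hbd⟩ := h.exists_bound_norm
  obtain ⟨J, hJ⟩ : ∃ J : ℕ, T' < switchTime T σ J :=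
    (((tendsto_switchTime hσ₀.le hσ₁).eventually (lt_mem_nhds hT'))).exists
  have ha0 : 0 ≤ a := zero_le_one.trans ha
  refine ⟨a ^ J * M₀, fun t ht x => ?_⟩
  by_cases htI : t ∈ Ico 0 (blowupTime T σ)
  · obtain ⟨j, hj⟩ := exists_mem_Ico_switchTime hσ₀ hσ₁ htI.1 htI.2
    have hjJ : j < J := by
      by_contra hle
      have hmono := (strictMono_switchTime h.T_pos hσ₀).monotone (not_lt.1 hle)
      linarith [hj.1, ht.2]
    rw [glueG_eq_pieceG h.T_pos hσ₀ τ a z u hj, pieceG_apply, norm_smul,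
      Real.norm_of_nonneg (pow_nonneg ha0 _)]
    have hloc : (σ⁻¹) ^ (2 * j) * (t - switchTime T σ j) ∈ Icc 0 T :=
      localTime_mem_Icc hσ₀ (Ico_subset_Icc_self hj)
    calc a ^ j * ‖u ((σ⁻¹) ^ (2 * j) * (t - switchTime T σ j))
          ((1 - τ)⁻¹ • z + (τ⁻¹) ^ j • (x - (1 - τ)⁻¹ • z))‖
        ≤ a ^ j * M₀ := mul_le_mul_of_nonneg_left (hbd _ hloc _) (pow_nonneg ha0 _)
      _ ≤ a ^ J * M₀ := mul_le_mul_of_nonneg_right (pow_le_pow_right₀ ha hjJ.le) hM₀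
  · rw [glueG_eq_zero_of_notMem_aux h.T_pos hσ₀ hσ₁ τ a z u htI]
    simpa using mul_nonneg (pow_nonneg ha0 J) hM₀

/-! ### The singular point -/

/-- **The blow-up point is singular** (`a > 1`): the generalised glued field is not essentially
bounded on any centred parabolic cylinder about `(T₀, x₀)`. With `x*` such that `u(0, x*) ≠ 0`,
the `j`-th piece equals `aʲu(0,x*)` at `(t_j, Γʲ(x*)) → (T₀, x₀)`, and by continuity `|𝔲| ≥ M + 1`
on an open set of positive measure inside the cylinder.
[cite: Ozanski2017NSISingular, §2 pp. 6–7] [cite: Scheffer1985, Lemma 2.3 (2.30)] -/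
theorem not_isRegularPoint_glueG (h : IsNSIBlock T ν₀ τ z G u) (hσ₀ : 0 < σ) (hσ₁ : σ < 1)
    (ha : 1 < a) :
    ¬ IsRegularPoint (glueG T σ τ a z u) (blowupTime T σ, blowupPoint τ z) := by
  rintro ⟨r, hr, hfin⟩
  have ha0 : 0 ≤ a := zero_le_one.trans ha.le
  -- the essential bound `M`
  set μ : Measure (ℝ × EuclideanSpace ℝ (Fin 3)) := volume.restrict
    (parabolicCylinderCentered r ((blowupTime T σ, blowupPoint τ z) : ℝ × EuclideanSpace ℝ (Fin 3)))
    with hμ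
  set M : ℝ≥0∞ := eLpNorm (uncurry (glueG T σ τ a z u)) ∞ μ with hM
  have hMfin : M < ⊤ := hfin
  have hae : ∀ᵐ q ∂μ, ‖uncurry (glueG T σ τ a z u) q‖ₑ ≤ M := by
    rw [hM, eLpNorm_exponent_top]
    exact ae_le_eLpNormEssSup
  set K : ℝ := M.toReal + 1 with hK
  have hKM : M < ENNReal.ofReal K := by
    rw [hK]
    calc M = ENNReal.ofReal M.toReal := (ENNReal.ofReal_toReal hMfin.ne).symm
      _ < ENNReal.ofReal (M.toReal + 1) :=
        ENNReal.ofReal_lt_ofReal_iff'.2 ⟨by linarith, by linarith [ENNReal.toReal_nonneg (a := M)]⟩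
  -- a point where `u(0)` does not vanish
  obtain ⟨xs, hxs⟩ := h.nontrivial
  have hpos : 0 < ‖u 0 xs‖ := norm_pos_iff.2 hxs
  -- choice of the piece index
  have ev1 : ∀ᶠ j : ℕ in atTop, blowupTime T σ - r ^ 2 < switchTime T σ j :=
    (tendsto_switchTime hσ₀.le hσ₁).eventually (lt_mem_nhds (by nlinarith))
  have ev2 : ∀ᶠ j : ℕ in atTop,
      dist ((fun y : EuclideanSpace ℝ (Fin 3) => τ • y + z)^[j] xs) (blowupPoint τ z) < r / 2 :=
    Metric.tendsto_nhds.1 (h.tendsto_similarity_iterate xs) (r / 2) (by positivity)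
  have ev3 : ∀ᶠ j : ℕ in atTop, K < a ^ j * ‖u 0 xs‖ :=
    ((tendsto_pow_atTop_atTop_of_one_lt ha).atTop_mul_const hpos).eventually_gt_atTop K
  obtain ⟨j, hj1, hj2, hj3⟩ := (ev1.and (ev2.and ev3)).exists
  -- the point `(t_j, Γʲ(x*))` and the value of the `j`-th piece there
  set tj : ℝ := switchTime T σ j with htj
  set xj : EuclideanSpace ℝ (Fin 3) := (fun y : EuclideanSpace ℝ (Fin 3) => τ • y + z)^[j] xs
    with hxj
  have hlt : tj < switchTime T σ (j + 1) := strictMono_switchTime h.T_pos hσ₀ (Nat.lt_succ_self j)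
  have hval : pieceG T σ τ a z u j tj xj = a ^ j • u 0 xs := by
    rw [hxj, similarity_iterate_eq h.τ_lt_one.ne z xs j, pieceG_apply_center_aux h.τ_pos.ne', htj,
      sub_self, mul_zero]
  have hnorm : K < ‖uncurry (pieceG T σ τ a z u j) (tj, xj)‖ := by
    simp only [uncurry_apply_pair, hval, norm_smul, Real.norm_of_nonneg (pow_nonneg ha0 j)]
    exact hj3
  -- continuity of the piece on its closed strip gives a neighbourhood where `|u^{(j)}| > K`
  have hcont := continuousOn_uncurry_pieceG_aux h hσ₀ a j
  have hmem : ((tj, xj) : ℝ × EuclideanSpace ℝ (Fin 3)) ∈ Icc tj (switchTime T σ (j + 1)) ×ˢ univ :=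
    ⟨⟨le_rfl, hlt.le⟩, mem_univ _⟩
  have hpre : (fun q => ‖uncurry (pieceG T σ τ a z u j) q‖) ⁻¹' Ioi K ∈
      𝓝[Icc tj (switchTime T σ (j + 1)) ×ˢ univ] ((tj, xj) : ℝ × EuclideanSpace ℝ (Fin 3)) :=
    ((hcont (tj, xj) hmem).norm).preimage_mem_nhdsWithin (Ioi_mem_nhds hnorm)
  obtain ⟨δ, hδ, hball⟩ := Metric.mem_nhdsWithin_iff.1 hpre
  -- the small open box `U` inside the strip, the neighbourhood and the cylinder
  set δ' : ℝ := min δ (min (r / 2) (switchTime T σ (j + 1) - tj)) with hδ'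
  have hδ'pos : 0 < δ' := lt_min hδ (lt_min (by positivity) (sub_pos.2 hlt))
  have hδ'δ : δ' ≤ δ := min_le_left _ _
  have hδ'r : δ' ≤ r / 2 := (min_le_right _ _).trans (min_le_left _ _)
  have hδ't : δ' ≤ switchTime T σ (j + 1) - tj := (min_le_right _ _).trans (min_le_right _ _)
  set U : Set (ℝ × EuclideanSpace ℝ (Fin 3)) := Ioo tj (tj + δ') ×ˢ ball xj δ' with hU
  have hUmeas : MeasurableSet U := measurableSet_Ioo.prod measurableSet_ball
  -- `U` lies in the cylinder
  have hUQ : U ⊆ parabolicCylinderCentered r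
      ((blowupTime T σ, blowupPoint τ z) : ℝ × EuclideanSpace ℝ (Fin 3)) := by
    rintro ⟨s, x⟩ ⟨hs, hx⟩
    rw [mem_parabolicCylinderCentered]
    refine ⟨⟨by linarith [hs.1], ?_⟩, ?_⟩
    · have := switchTime_lt_blowupTime h.T_pos hσ₀ hσ₁ (j + 1)
      have hr2 : 0 < r ^ 2 := by positivity
      simp only
      linarith [hs.2]
    · calc dist x (blowupPoint τ z) ≤ dist x xj + dist xj (blowupPoint τ z) := dist_triangle _ _ _
        _ < δ' + r / 2 := add_lt_add (mem_ball.1 hx) hj2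
        _ ≤ r := by linarith
  -- on `U` the glued field is the `j`-th piece and exceeds `K`
  have hUK : ∀ q ∈ U, K < ‖uncurry (glueG T σ τ a z u) q‖ := by
    rintro ⟨s, x⟩ ⟨hs, hx⟩
    have hsI : s ∈ Ico tj (switchTime T σ (j + 1)) := ⟨hs.1.le, by linarith [hs.2]⟩
    have hq : ((s, x) : ℝ × EuclideanSpace ℝ (Fin 3)) ∈
        ball ((tj, xj) : ℝ × EuclideanSpace ℝ (Fin 3)) δ ∩
          (Icc tj (switchTime T σ (j + 1)) ×ˢ univ) := by
      refine ⟨?_, ⟨Ico_subset_Icc_self hsI, mem_univ _⟩⟩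
      rw [mem_ball, Prod.dist_eq, max_lt_iff]
      refine ⟨?_, (mem_ball.1 hx).trans_le hδ'δ⟩
      rw [Real.dist_eq, abs_of_pos (sub_pos.2 hs.1)]
      linarith [hs.2]
    have := hball hq
    simp only [mem_preimage, mem_Ioi, uncurry_apply_pair] at this
    simpa only [uncurry_apply_pair, glueG_eq_pieceG h.T_pos hσ₀ τ a z u hsI] using this
  -- `U` has positive measure ...
  have hUpos : 0 < μ U := by
    rw [hμ, Measure.restrict_apply hUmeas, inter_eq_left.2 hUQ, hU, Measure.volume_eq_prod,
      Measure.prod_prod, Real.volume_Ioo, add_sub_cancel_left]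
    exact ENNReal.mul_pos (ENNReal.ofReal_pos.2 hδ'pos).ne' (measure_ball_pos volume xj hδ'pos).ne'
  -- ... but the essential bound forces it to be null
  have hU0 : μ U = 0 := by
    rw [ae_iff] at hae
    refine measure_mono_null (fun q hq => ?_) hae
    simp only [mem_setOf_eq, not_le]
    calc M < ENNReal.ofReal K := hKM
      _ ≤ ENNReal.ofReal ‖uncurry (glueG T σ τ a z u) q‖ := ENNReal.ofReal_le_ofReal (hUK q hq).le
      _ = ‖uncurry (glueG T σ τ a z u) q‖ₑ := ofReal_norm _
  exact absurd hU0 hUpos.ne'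

/-! ### The super-`1/2` blow-up rate -/

/-- **Uniform nontriviality of an NSI block**: `inf_{s ∈ [0,T]} max_y ‖u(s,y)‖ > 0`, i.e. there
is `m > 0` such that every slice `u(s)`, `s ∈ [0,T]`, has a point with `‖u(s,y)‖ ≥ m`
(compactness of `[0,T]`, joint continuity, and `tsupport u(s) = G ∋ x*`). [cite: Ozanski2017NSISingular, §2.1 (p. 6)] -/
theorem exists_pos_forall_exists_le_norm (h : IsNSIBlock T ν₀ τ z G u) :
    ∃ m : ℝ, 0 < m ∧ ∀ s ∈ Icc 0 T, ∃ y, m ≤ ‖u s y‖ := by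
  by_contra H
  push Not at H
  -- a sequence of slices with `sup ‖u(s_n)‖ < 1/(n+1)`
  have hseq : ∀ n : ℕ, ∃ s ∈ Icc 0 T, ∀ y, ‖u s y‖ < 1 / ((n : ℝ) + 1) := fun n =>
    H _ (by positivity)
  choose s hs hsmall using hseq
  obtain ⟨s₀, hs₀, φ, hφ, hlim⟩ := isCompact_Icc.tendsto_subseq hs
  -- every value of the limit slice vanishes
  have hzero : ∀ y, u s₀ y = 0 := by
    intro y
    have hcont : ContinuousOn (uncurry u ∘ fun r : ℝ => ((r, y) : ℝ × EuclideanSpace ℝ (Fin 3)))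
        (Icc 0 T) :=
      h.continuousOn_uncurry.comp (continuous_id.prodMk continuous_const).continuousOn
        fun r hr => ⟨hr, mem_univ _⟩
    have hlim' : Tendsto (fun n => u (s (φ n)) y) atTop (𝓝 (u s₀ y)) := by
      have := (hcont s₀ hs₀).tendsto.comp
        (tendsto_nhdsWithin_iff.2 ⟨hlim, Eventually.of_forall fun n => hs (φ n)⟩)
      simpa [Function.comp_def] using this
    have hnorm : Tendsto (fun n => ‖u (s (φ n)) y‖) atTop (𝓝 0) := by
      have hφt : Tendsto (fun n => 1 / ((φ n : ℝ) + 1)) atTop (𝓝 0) :=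
        (tendsto_one_div_add_atTop_nhds_zero_nat (𝕜 := ℝ)).comp hφ.tendsto_atTop
      exact squeeze_zero (fun n => norm_nonneg _) (fun n => (hsmall (φ n) y).le) hφt
    exact norm_eq_zero.1 (tendsto_nhds_unique hlim'.norm hnorm)
  -- but `tsupport u(s₀) = G` contains `x*` with `u(0,x*) ≠ 0`
  obtain ⟨xs, hxs⟩ := h.nontrivial
  have hxG : xs ∈ G := by
    rw [← h.tsupport_eq 0 ⟨le_rfl, h.T_pos.le⟩]
    exact subset_tsupport _ (mem_support.2 hxs)
  have hsupp : tsupport (u s₀) = ∅ := by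
    rw [tsupport, show support (u s₀) = ∅ from support_eq_empty_iff.2 (funext hzero), closure_empty]
  rw [h.tsupport_eq s₀ hs₀] at hsupp
  exact (hsupp ▸ hxG : xs ∈ (∅ : Set (EuclideanSpace ℝ (Fin 3))))

/-- **The super-`1/2` rate of the generalised glued field** (`0 < σ < 1`, `aσ > 1`): with
`β = log_{σ⁻²} a` (so `(σ⁻²)^β = a`, and `β > 1/2 ⇔ a > σ⁻¹`) there is `c > 0` such that at every
`t ∈ [0, T₀)` some point has `c (T₀ - t)^{-β} ≤ ‖𝔲(t, x)‖`: on the `j`-th life span,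
`T₀ - t > T₀ - t_{j+1} = σ^{2(j+1)}T₀`, so `(T₀ - t)^{-β} < a^{j+1} T₀^{-β}`, while
`‖u^{(j)}(t, Γʲy)‖ = aʲ‖u(s,y)‖ ≥ aʲ m`. [cite: Ozanski2017NSISingular, §2.1 (p. 6)] -/
theorem exists_rate_glueG (h : IsNSIBlock T ν₀ τ z G u) (hσ₀ : 0 < σ) (hσ₁ : σ < 1)
    (haσ : 1 < a * σ) :
    ∃ β c : ℝ, 1 / 2 < β ∧ 0 < c ∧
      ∀ t ∈ Ico 0 (blowupTime T σ), ∃ x, c * (blowupTime T σ - t) ^ (-β) ≤ ‖glueG T σ τ a z u t x‖ := by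
  have ha : 0 < a := (mul_pos_iff_of_pos_right hσ₀).1 (zero_lt_one.trans haσ)
  obtain ⟨m, hm, hmu⟩ := exists_pos_forall_exists_le_norm h
  -- the base `b = σ⁻² > 1` and the exponent `β = log_b a`
  set b : ℝ := (σ⁻¹) ^ 2 with hb
  have hσinv : 1 < σ⁻¹ := (one_lt_inv₀ hσ₀).2 hσ₁
  have hb1 : 1 < b := by rw [hb]; nlinarith
  have hb0 : 0 < b := one_pos.trans hb1
  set β : ℝ := Real.logb b a with hβ
  have hbβ : b ^ β = a := Real.rpow_logb hb0 hb1.ne' ha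
  have hβhalf : 1 / 2 < β := by
    rw [hβ, Real.lt_logb_iff_rpow_lt hb1 ha]
    have : b ^ (1 / 2 : ℝ) = σ⁻¹ := by
      rw [hb, ← Real.sqrt_eq_rpow, Real.sqrt_sq (inv_pos.2 hσ₀).le]
    rw [this]
    have := mul_lt_mul_of_pos_right haσ (inv_pos.2 hσ₀)
    rwa [one_mul, mul_assoc, mul_inv_cancel₀ hσ₀.ne', mul_one] at this
  have hβ0 : 0 < β := by linarith
  have hT₀ : 0 < blowupTime T σ := div_pos h.T_pos (by nlinarith)
  -- the constant
  refine ⟨β, m * a⁻¹ * (blowupTime T σ) ^ β, hβhalf, by positivity, fun t ht => ?_⟩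
  obtain ⟨j, hj⟩ := exists_mem_Ico_switchTime hσ₀ hσ₁ ht.1 ht.2
  -- the local time and a point of the slice with `‖u‖ ≥ m`
  have hloc : (σ⁻¹) ^ (2 * j) * (t - switchTime T σ j) ∈ Icc 0 T :=
    localTime_mem_Icc hσ₀ (Ico_subset_Icc_self hj)
  obtain ⟨y, hy⟩ := hmu _ hloc
  refine ⟨(1 - τ)⁻¹ • z + τ ^ j • (y - (1 - τ)⁻¹ • z), ?_⟩
  rw [glueG_eq_pieceG h.T_pos hσ₀ τ a z u hj, pieceG_apply_center_aux h.τ_pos.ne', norm_smul,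
    Real.norm_of_nonneg (pow_nonneg ha.le _)]
  -- `(T₀ - t)^{-β} ≤ (σ^{2(j+1)} T₀)^{-β} = a^{j+1} T₀^{-β}`
  have hσ2 : σ ^ 2 ≠ 1 := (pow_lt_one₀ hσ₀.le hσ₁ two_ne_zero).ne
  have hgap : blowupTime T σ - switchTime T σ (j + 1) = σ ^ (2 * (j + 1)) * blowupTime T σ :=
    blowupTime_sub_switchTime T hσ2 (j + 1)
  have hpos1 : 0 < σ ^ (2 * (j + 1)) * blowupTime T σ := by positivity
  have hle1 : σ ^ (2 * (j + 1)) * blowupTime T σ ≤ blowupTime T σ - t := by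
    rw [← hgap]; linarith [hj.2]
  have hanti : (blowupTime T σ - t) ^ (-β) ≤ (σ ^ (2 * (j + 1)) * blowupTime T σ) ^ (-β) :=
    Real.rpow_le_rpow_of_nonpos hpos1 hle1 (by linarith)
  have hpow : (σ ^ (2 * (j + 1))) ^ (-β) = a ^ (j + 1) := by
    have e1 : σ ^ (2 * (j + 1)) = (b ^ (j + 1))⁻¹ := by
      rw [hb, ← pow_mul, inv_pow, inv_inv]
    rw [e1, Real.inv_rpow (pow_nonneg hb0.le _), Real.rpow_neg (pow_nonneg hb0.le _), inv_inv,
      ← Real.rpow_natCast b (j + 1), ← Real.rpow_mul hb0.le, mul_comm, Real.rpow_mul hb0.le, hbβ,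
      Real.rpow_natCast]
  have hkey : (σ ^ (2 * (j + 1)) * blowupTime T σ) ^ (-β) = a ^ (j + 1) * (blowupTime T σ) ^ (-β) := by
    rw [Real.mul_rpow (pow_nonneg hσ₀.le _) hT₀.le, hpow]
  -- assemble: `c (T₀-t)^{-β} ≤ c a^{j+1} T₀^{-β} = m aʲ ≤ aʲ ‖u(s,y)‖`
  calc m * a⁻¹ * blowupTime T σ ^ β * (blowupTime T σ - t) ^ (-β)
      ≤ m * a⁻¹ * blowupTime T σ ^ β * (a ^ (j + 1) * (blowupTime T σ) ^ (-β)) := by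
        rw [← hkey]; exact mul_le_mul_of_nonneg_left hanti (by positivity)
    _ = a ^ j * m := by
        rw [Real.rpow_neg hT₀.le, pow_succ]
        field_simp
    _ ≤ a ^ j * ‖u ((σ⁻¹) ^ (2 * j) * (t - switchTime T σ j)) y‖ :=
        mul_le_mul_of_nonneg_left hy (pow_nonneg ha.le _)

end Literature.Barriers.NavierStokesRegularity.NSISuperCascade

end Part7

/-! ## Part 8 — the EXACT discharge `NSITypeIIBlowup_holds` -/

open _root_.MeasureTheory _root_.Set _root_.Function _root_.Filter _root_.Topology _root_.TopologicalSpace _root_.Metric _root_.Module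
open scoped ENNReal InnerProductSpace RealInnerProductSpace ContDiff Laplacian
open Literature.Analysis.FluidPDE Literature.Barriers.NavierStokesRegularity
open Literature.Barriers.NavierStokesRegularity.Scheffer
open Literature.Barriers.NavierStokesRegularity.NSISuperCascade

namespace Literature.Barriers.NavierStokesRegularity

/-- **The barrier `NSITypeIIBlowup` HOLDS** («suitability is rate-blind»: the Navier–Stokes inequality class admits a compactly supported,
spatially smooth weak solution, for every small viscosity, with a first blow-up of NON-Type-I rate `β > 1/2`).  EXACT-name discharge,
assembled exactly as the Summits-side `Summit.NavierStokesRegularity.NavierStokesRegularity.Theorems.TypeIliouvilleNoTypeIINegative.NSITypeIIBlowup_holds`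
from B1 (`NSISuperCascade.exists_superGain_nsiBlock`), the capped parameters (`NSISuperCascade.superCascade_params`), B2
(`NSISuperCascade.IsSuperBlock.isNSIWeakSolution_glueG`, `…contDiff_glueG`, `…hasCompactSupport_glueG`) and B3
(`NSISuperCascade.isSingularPoint_glueG`, `…exists_bound_glueG`, `…rate_glueG`).
[cite: Ozanski2017NSISingular, §2 pp. 6–7, §5.5 (5.16), (5.29)–(5.31)] -/
theorem NSITypeIIBlowup_holds : NSITypeIIBlowup := by
  obtain ⟨T, ν₀, τ, z, G, u, g, hblock, hg, hgain⟩ := exists_superGain_nsiBlock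
  have hτ₀ := hblock.τ_pos
  have hτ₁ := hblock.τ_lt_one
  have hsqrt_pos : 0 < Real.sqrt τ := Real.sqrt_pos.2 hτ₀
  have hsqrt_lt : Real.sqrt τ < 1 := by
    rw [Real.sqrt_lt' one_pos, one_pow]
    exact hτ₁
  -- the amplitude: the block's gain, capped at `τ^{-3/2}` (energy cap `a²τ³ ≤ 1`)
  obtain ⟨a, hinv_lt, hcap, hle⟩ : ∃ a : ℝ, τ⁻¹ < a ∧ a ^ 2 * τ ^ 3 ≤ 1 ∧ a ≤ g := by
    refine ⟨min g (τ⁻¹ * (Real.sqrt τ)⁻¹), lt_min hg ?_, ?_, min_le_left _ _⟩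
    · have h1 : 1 < (Real.sqrt τ)⁻¹ := (one_lt_inv₀ hsqrt_pos).2 hsqrt_lt
      calc τ⁻¹ = τ⁻¹ * 1 := (mul_one _).symm
        _ < τ⁻¹ * (Real.sqrt τ)⁻¹ := mul_lt_mul_of_pos_left h1 (inv_pos.2 hτ₀)
    · have h0 : 0 ≤ min g (τ⁻¹ * (Real.sqrt τ)⁻¹) :=
        le_min ((inv_pos.2 hτ₀).trans hg).le (mul_nonneg (inv_pos.2 hτ₀).le (inv_pos.2 hsqrt_pos).le)
      have h2 : min g (τ⁻¹ * (Real.sqrt τ)⁻¹) ^ 2 ≤ (τ⁻¹ * (Real.sqrt τ)⁻¹) ^ 2 :=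
        pow_le_pow_left₀ h0 (min_le_right _ _) 2
      have hτne : τ ≠ 0 := hτ₀.ne'
      have h3 : (τ⁻¹ * (Real.sqrt τ)⁻¹) ^ 2 * τ ^ 3 = 1 := by
        rw [mul_pow, inv_pow, inv_pow, Real.sq_sqrt hτ₀.le]
        field_simp
      calc min g (τ⁻¹ * (Real.sqrt τ)⁻¹) ^ 2 * τ ^ 3 ≤ (τ⁻¹ * (Real.sqrt τ)⁻¹) ^ 2 * τ ^ 3 :=
          mul_le_mul_of_nonneg_right h2 (pow_nonneg hτ₀.le 3)
        _ = 1 := h3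
  have hgain' : ∀ y : EuclideanSpace ℝ (Fin 3), a * ‖u 0 y‖ ≤ ‖u T (τ • y + z)‖ := fun y =>
    (mul_le_mul_of_nonneg_right hle (norm_nonneg _)).trans (hgain y)
  -- the clock `σ = √(τ/a)`: `aσ² = τ`, `σ < 1`, `aσ > 1`
  obtain ⟨hσ₀, hσ₁, hcov, haσ, -⟩ := superCascade_params hτ₀ hτ₁ hinv_lt
  have hS : IsSuperBlock T ν₀ τ (Real.sqrt (τ / a)) a z G u := ⟨hblock, hσ₀, hcov, hinv_lt, hcap, hgain'⟩
  have hT₀ : 0 < blowupTime T (Real.sqrt (τ / a)) :=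
    div_pos hblock.T_pos (by nlinarith [hS.σ_sq_lt_one])
  exact ⟨ν₀, hblock.ν₀_pos, G, glueG T (Real.sqrt (τ / a)) τ a z u,
    fun t => normalisedPressure (glueG T (Real.sqrt (τ / a)) τ a z u t), hblock.isCompact,
    fun ν hν => hS.isWeakNSISolution_glueG hν,
    fun t _ => ⟨hS.contDiff_glueG_slice t, hS.tsupport_glueG_slice_subset t⟩,
    blowupTime T (Real.sqrt (τ / a)), blowupPoint τ z, hT₀,
    not_isRegularPoint_glueG hblock hσ₀ hσ₁ hS.one_lt_gain,
    exists_bound_glueG hblock hσ₀ hσ₁ hS.one_lt_gain.le,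
    exists_rate_glueG hblock hσ₀ hσ₁ haσ⟩

end Literature.Barriers.NavierStokesRegularity

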